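import Mathlib.Analysis.InnerProductSpace.Calculus
import Mathlib.MeasureTheory.Integral.IntervalIntegral.FundThmCalculus
import Literature.Geometry.Lorentzian.KerrEnergyIdentity
import HarnessLib

/-!
# The hyperboloidal leaves `Σ̃_τ(h♯_{R₁})` of the Kerr exterior are spacelike with future
# timelike normal; the Kerr–Schild slices are spacelike (discharges)

(trunk G08 = T-LORENTZ; statement **gr.S24**; namespaces `Literature.Lorentz.Kerr`, `Literature.Geometry.Lorentzian.E4`,
`Literature.Lorentz.OpensChart`)

This file belongs to the decomposition of the named fact `Literature.Geometry.Lorentzian.drsr_wave_polynomial_decay_kerr`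
(`BlackHoles.lean`; Dafermos–Rodnianski–Shlapentokh-Rothman, arXiv:1402.7034, Cor. 3.1), reduced
in `KerrHyperboloidalFlux.lean` to the named fact `Kerr.drsr_corollary_3_1_scri_flux_decay`:
decay of the energy flux `∫ T[ψ](V, W) dy` through the leaves
`Σ̃_τ(h♯_{R₁}) = {t*_KS = τ + h♯_{R₁}(y)}` of a hyperboloidal foliation terminating at `𝓘⁺`. The
derivation of that fact from the printed Cor. 3.1 (its docstring, and *The corrected foliation*
in the module docstring of `KerrHyperboloidalFlux.lean`) uses that (i) the leaves terminate at
`𝓘⁺` (proved there: `Kerr.integrableOn_outgoingNullSlope_sub_scriSlope`) and (ii) **the leaves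
are smooth spacelike hypersurfaces of the exterior with future-directed timelike normal
`W = −g♯d(t* − h♯_{R₁})`** for `R₁ ≥ R₀(M, a)`. This file **proves (ii)**, with the explicit
threshold `R₀ = 2M`, by a computation in ingoing Kerr–Schild Cartesian coordinates:

* `Kerr.blSigma a y = 2r² − ‖y‖² + a²` (`= r² + a² cos²θ`, the Boyer–Lindquist `Σ`, by the
  quartic `r²Σ = r⁴ + a²z²`, `Kerr.sq_mul_blSigma`); `Kerr.scalarH_ofTimeSpace_eq` (`H = Mr/Σ`);
* `Kerr.radiusGradVec`, `Kerr.radiusGrad` and **`Kerr.hasFDerivAt_radius_slice`**: the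
  Kerr–Schild radius `y ↦ r(0, y)` is differentiable off the disc with gradient
  `∇r = (r² y + a² z e_z)/(rΣ)` (implicit differentiation of the quartic); the two identities
  **`Kerr.radiusGrad_nullSpatial : dr(ℓ⃗) = 1`** and
  **`Kerr.inner_radiusGradVec_self : |∇r|² = (r² + a²)/Σ`** (Visser arXiv:0706.0622, (34)–(35));
* `Kerr.hasDerivAt_cutoffProfile`, `Kerr.contDiffOn_cutoffProfile`, `Kerr.hasFDerivAt_cutoffHeight`,
  `Kerr.contDiffOn_cutoffHeight`: `k' = χ((r − R₁)/R₁) σ(r)` (fundamental theorem of calculus) and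
  `dh = k'(r) dr`, smoothness on `(r₊, ∞)`;
* for a height with `dh_y = c · dr` (`Kerr.leafConormal_*_of_radial`): `ν(ℓ♯) = −(1 + c)`,
  `η⁻¹(ν, ν) = −1 + c²(r² + a²)/Σ`, **`g⁻¹(ν, ν) = (−Σ + c²(r² + a²) − 2Mr(1 + c)²)/Σ`**
  (`g⁻¹ = η⁻¹ − 2H ℓ♯ ⊗ ℓ♯`, `Kerr.coSharp`), `ν(V) = 1 + 2H(1 + c)`;
* the sign (`Kerr.leafQuadratic_lt_sq`, `Kerr.leafQuadratic_scriSlope_lt_sq`,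
  `Kerr.scri_quartic_neg`): `P(c) := c²(r² + a²) − 2Mr(1 + c)² < r² ≤ Σ` for every slope
  `0 ≤ c ≤ σ♯(r) = scriSlope M a r` provided `c = 0` or `r ≥ 2M` (convexity in `c`;
  `P(0) = −2Mr`; `r²Δ(r² − P(σ♯)) = −N` with the quartic
  `N = (a² − 8M²)r⁴ + 2Ma²r³ + (a² − 4M²)²r² + 4Ma²(a² − 4M²)r + 4M²a⁴ < 0` for `r ≥ 2M`,
  `|a| < M`);
* **`Kerr.isTimelike_leafNormal_scriHeight`**, **`Kerr.isFutureDirected_leafNormal_scriHeight`**: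
  for `|a| < M`, `R₁ > 2M`, at every point of the exterior `{r > r₊}` the leaf normal
  `W = Kerr.leafNormal M a (scriHeight M a R₁) x` is timelike and future-directed for the Kerr time
  orientation; **`Kerr.stressEnergy_timeVector_leafNormal_scriHeight_nonneg`**: the flux density
  `T[ψ](V, W)` of `Kerr.leafFluxDensity` is `≥ 0` (dominant energy condition,
  `EnergyCurrents.lean`), so its `ENNReal.ofReal` truncates nothing;
  **`Kerr.isSpacelikeImmersion_scriLeaf`**: `y ↦ (τ + h♯_{R₁}(y), y)` is a `C^∞` spacelike immersion
  `Kerr.slice a r₊ → Kerr.exterior M a` (`Hypersurface.lean`), for every `τ`; the generic versions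
  `Kerr.isTimelike_leafNormal_cutoffHeight`, `Kerr.isSpacelikeImmersion_leafEmbed` cover every
  cut-off foliation with far slope between the Kerr–Schild slice and `σ♯`
  (also `Kerr.isTimelike_leafNormal_hypHeight`: the `i⁰`-reaching leaves of the first version are
  spacelike as well);
* by-products: `OpensChart.hasMFDerivAt_codRestrict` (derivatives of maps into open
  submanifolds), `Kerr.mfderiv_sliceEmbed` (`= E4.spaceEmbed` of `KerrEnergyIdentity.lean`, the
  differential `v ↦ (0, v)` of the slice maps), and the **discharges of the named facts
  `Kerr.isSpacelikeImmersion_sliceEmbed`** (a field of `Kerr.SliceFacts`; induced form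
  `‖v‖² + 2H(ℓ⃗·v)² > 0`, Cook 2000, §3.2.2, (55)) **and `Kerr.isFutureUnitNormal_sliceNormal`**
  (`ν = (1 + 2H)^{-1/2} V`; Cook 2000, §3.2.2) of `KerrData.lean`:
  `Kerr.isSpacelikeImmersion_sliceEmbed_holds`, `Kerr.isFutureUnitNormal_sliceNormal_holds`
  (the facts stay `def`s, D-0014; their users can now be fed the proofs).

Relation to the Boyer–Lindquist criterion quoted in `KerrHyperboloidalFlux.lean` ((ii) of *The
corrected foliation*): a graph `t = G(r)` is spacelike iff
`|G'| < ((r² + a²)² − a²Δ sin²θ)^{1/2}/Δ`; with `k' = G' + r*' − 1` and `Σ = r² + a²cos²θ` this is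
exactly `−Σ + P(k') < 0`, and the
`θ`-uniform sufficient condition `P(k') < r²` used here is `|G'| < ((r² + a²)² − a²Δ)^{1/2}/Δ`.

## References

* M. Dafermos, I. Rodnianski, Y. Shlapentokh-Rothman, *Decay for solutions of the wave equation
  on Kerr exterior spacetimes III: the full subextremal case |a| < M*, Ann. of Math. 183 (2016),
  arXiv:1402.7034, §2.1.1 (`Δ`, `ρ² = Σ`), §3.1, §3.3 Cor. 3.1 (key
  `DafermosRodnianskiShlapentokhrothman2014`).
* G. Moschidis, *The `r^p`-weighted energy method of Dafermos and Rodnianski in general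
  asymptotically flat spacetimes and applications*, Ann. PDE 2 (2016), arXiv:1509.08489, §1.3.3
  (restatement of Cor. 3.1: `Σ̃₀` smooth spacelike, transversal to `𝓗⁺`, terminating at `𝓘⁺`)
  (key `Moschidis2016`).
* M. Visser, *The Kerr spacetime: a brief introduction*, arXiv:0706.0622, (33)–(35) and §5
  (key `arXiv07060622`); R. P. Kerr, A. Schild, 1965, §§2–3 (key `KerrSchild1965`).
* G. B. Cook, *Initial data for numerical relativity*, Living Rev. Relativ. 3 (2000) 5, §3.2.2,
  (55)–(57) (Kerr–Schild slices: lapse, shift, induced metric) (key `Cook2000`).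
* B. O'Neill, *Semi-Riemannian geometry*, 1983, Ch. 4 p. 97, Ch. 5 Lemma 5.26 and p. 145
  (key `ONeill1983`); *The geometry of Kerr black holes*, 1995, Ch. 2 §2.3 (key `ONeill1995`).
* M. Dafermos, I. Rodnianski, *Lectures on black holes and linear waves*, arXiv:0811.0354, §5.1
  (key `arXiv08110354`).
-/

noncomputable section

open Bundle Set TopologicalSpace Filter
open scoped Manifold ContDiff Topology RealInnerProductSpace

namespace Literature.Geometry.Lorentzian

/-! ### Maps into open submanifolds: derivatives of corestrictions -/

namespace OpensChart

variable {E : Type*} [NormedAddCommGroup E] [NormedSpace ℝ E] {H : Type*} [TopologicalSpace H]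
  {I : ModelWithCorners ℝ E H} {E' : Type*} [NormedAddCommGroup E'] [NormedSpace ℝ E']
  {H' : Type*} [TopologicalSpace H'] {I' : ModelWithCorners ℝ E' H'}
  {X : Type*} [TopologicalSpace X] [ChartedSpace H X]
  {M' : Type*} [TopologicalSpace M'] [ChartedSpace H' M']
  {U' : Opens M'} {f : X → M'} {φ : X → U'}

/-- A corestriction `φ : X → U'` of `f : X → M'` to an open submanifold (`↑(φ y) = f y`) has at
`x` every manifold derivative that `f` has: the chart of `U'` at `φ x` is the restricted chart of
`M'` at `f x`, so the local representatives coincide (Lee, *Introduction to Smooth Manifolds*,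
Ex. 1.26 and Prop. 3.9: `T_p U = T_p M`). Same statement as `Literature.Topology.FourManifolds.hasMFDerivAt_codRestrict_opens`
of the four-manifold files, reproved here to keep the Lorentzian import graph independent of
them. [folklore] -/
theorem hasMFDerivAt_codRestrict (hφ : ∀ y, (φ y : M') = f y) {x : X} {f' : E →L[ℝ] E'}
    (hf : HasMFDerivAt I I' f x f') : HasMFDerivAt I I' φ x f' := by
  have hw : writtenInExtChartAt I I' x φ = writtenInExtChartAt I I' x f := by
    funext z
    simp only [writtenInExtChartAt, Function.comp_apply, _root_.extChartAt_coe, Opens.chartAt_eq,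
      OpenPartialHomeomorph.subtypeRestr_coe, Set.restrict_apply, hφ]
  refine ⟨?_, ?_⟩
  · rw [Topology.IsInducing.subtypeVal.continuousAt_iff]
    exact hf.1.congr_of_eventuallyEq (Eventually.of_forall hφ)
  · have heq : writtenInExtChartAt I I' x φ =ᶠ[𝓝 ((extChartAt I x) x)]
        writtenInExtChartAt I I' x f :=
      Eventually.of_forall fun z ↦ congrFun hw z
    exact hf.2.congr_of_eventuallyEq (heq.filter_mono nhdsWithin_le_nhds) heq.eq_of_nhds

/-- The manifold derivative of a corestriction to an open submanifold is that of the map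
(Lee, Prop. 3.9). [folklore] -/
theorem mfderiv_codRestrict (hφ : ∀ y, (φ y : M') = f y) {x : X}
    (hf : MDifferentiableAt I I' f x) : mfderiv I I' φ x = mfderiv I I' f x :=
  (hasMFDerivAt_codRestrict hφ hf.hasMFDerivAt).mfderiv

/-- A corestriction to an open submanifold is differentiable where the map is (Lee, Prop. 3.9).
[folklore] -/
theorem mdifferentiableAt_codRestrict (hφ : ∀ y, (φ y : M') = f y) {x : X}
    (hf : MDifferentiableAt I I' f x) : MDifferentiableAt I I' φ x :=
  (hasMFDerivAt_codRestrict hφ hf.hasMFDerivAt).mdifferentiableAt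

end OpensChart

/-! ### The slice maps `y ↦ (t, y)` and their differential -/

namespace E4

/-- The slice map `y ↦ (t, y)` is affine with differential `spaceEmbed`. [folklore] -/
theorem hasFDerivAt_ofTimeSpace (t : ℝ) (y : E3) : HasFDerivAt (ofTimeSpace t) spaceEmbed y := by
  have : ofTimeSpace t = fun y ↦ t • basisVector 0 + spaceEmbed y :=
    funext (ofTimeSpace_eq_smul_add' t)
  rw [this]
  exact spaceEmbed.hasFDerivAt.const_add _

/-- The slice maps are `C^n` for every `n` (affine); the `ContDiff` form of
`E4.contMDiff_ofTimeSpace` of `KerrData.lean`. [folklore] -/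
theorem contDiff_ofTimeSpace (t : ℝ) {n : WithTop ℕ∞} : ContDiff ℝ n (ofTimeSpace t) :=
  contMDiff_iff_contDiff.1 (E4.contMDiff_ofTimeSpace t n)

/-- `(df v) ∂₀ + (0, v) = (df v, v)`. [folklore] -/
theorem smulRight_add_spaceEmbed_apply (f' : E3 →L[ℝ] ℝ) (v : E3) :
    (f'.smulRight (basisVector 0) + spaceEmbed) v = ofTimeSpace (f' v) v := by
  rw [ofTimeSpace_eq_smul_add']
  simp

/-- `spatial (0, v) = v`. [folklore] -/
@[simp]
theorem spatial_spaceEmbed (v : E3) : spatial (spaceEmbed v) = v := by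
  simp

end E4

namespace Kerr

/-! ### The differential of the slice embedding; the Kerr–Schild slices are spacelike -/

/-- The slice embedding `y ↦ (0, y)` of `Kerr.slice a r₀` into `Kerr.region a r₀` has manifold
derivative `E4.spaceEmbed : v ↦ (0, v)` at every point. Dafermos–Rodnianski arXiv:0811.0354,
§5.1. [folklore] -/
theorem hasMFDerivAt_sliceEmbed (a r₀ : ℝ) (y : slice a r₀) :
    HasMFDerivAt 𝓘(ℝ, E3) 𝓘(ℝ, E4) (sliceEmbed a r₀) y E4.spaceEmbed := by
  have hd : DifferentiableAt ℝ (E4.ofTimeSpace 0) (y : E3) :=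
    (E4.hasFDerivAt_ofTimeSpace 0 y).differentiableAt
  have h1 : HasMFDerivAt 𝓘(ℝ, E3) 𝓘(ℝ, E4) (fun y : slice a r₀ ↦ E4.ofTimeSpace 0 (y : E3)) y
      E4.spaceEmbed := by
    have hmd : MDifferentiableAt 𝓘(ℝ, E3) 𝓘(ℝ, E4)
        (fun y : slice a r₀ ↦ E4.ofTimeSpace 0 (y : E3)) y :=
      (OpensChart.mdifferentiableAt_iff y _ (E4.ofTimeSpace 0) (fun _ ↦ rfl)).2 hd
    have := hmd.hasMFDerivAt
    rwa [OpensChart.mfderiv_eq y _ (E4.ofTimeSpace 0) (fun _ ↦ rfl) hd,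
      (E4.hasFDerivAt_ofTimeSpace 0 y).fderiv] at this
  exact OpensChart.hasMFDerivAt_codRestrict (fun _ ↦ rfl) h1

/-- `d(sliceEmbed)_y = E4.spaceEmbed`. Dafermos–Rodnianski arXiv:0811.0354, §5.1. [folklore] -/
theorem mfderiv_sliceEmbed (a r₀ : ℝ) (y : slice a r₀) :
    mfderiv 𝓘(ℝ, E3) 𝓘(ℝ, E4) (sliceEmbed a r₀) y = E4.spaceEmbed :=
  (hasMFDerivAt_sliceEmbed a r₀ y).mfderiv

/-- The induced form of the Kerr–Schild slice on a tangent vector `(0, v)`: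
`g((0,v),(0,v)) = ‖v‖² + 2H (ℓ⃗·v)²` (Cook 2000, §3.2.2, (55): `h = δ + 2H ℓ⃗ ⊗ ℓ⃗`). [cite: Cook2000, §3.2.2 (55)] -/
theorem bilin_spaceEmbed_spaceEmbed (M a : ℝ) (x : E4) (v : E3) :
    bilin M a x (E4.spaceEmbed v) (E4.spaceEmbed v) =
      ‖v‖ ^ 2 + 2 * scalarH M a x * nullCovector a x (E4.spaceEmbed v) ^ 2 := by
  rw [bilin_apply, Minkowski.bilin_apply, EuclideanSpace.real_norm_sq_eq]
  simp only [E4.spaceEmbed_apply, E4.ofTimeSpace_apply_zero, E4.ofTimeSpace_apply_succ, mul_zero,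
    neg_zero, zero_add]
  ring

/-- **Discharge of the named fact `Kerr.isSpacelikeImmersion_sliceEmbed`** (a field of
`Kerr.SliceFacts`): for `M ≥ 0` the Kerr–Schild slice `{t* = 0}` is a spacelike immersion, since
the induced form is `‖v‖² + 2H (ℓ⃗·v)² ≥ ‖v‖² > 0` for `v ≠ 0` (`H ≥ 0`). Cook 2000, §3.2.2,
(55); Dafermos–Rodnianski arXiv:0811.0354, §5.1. [cite: Cook2000, §3.2.2 (55)] -/
theorem isSpacelikeImmersion_sliceEmbed_holds [Facts] (M a r₀ : ℝ) :
    isSpacelikeImmersion_sliceEmbed M a r₀ := by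
  intro hM
  refine ⟨contMDiff_sliceEmbed a r₀ _, fun y v hv ↦ ?_⟩
  rw [PseudoRiemannianMetric.inducedBilin_apply, mfderiv_sliceEmbed, smoothMetric_val,
    coe_sliceEmbed]
  set w : E3 := v with hw
  have hw0 : w ≠ 0 := hv
  have h1 : 0 < ‖w‖ ^ 2 := by positivity
  have h2 : 0 ≤ 2 * scalarH M a (E4.ofTimeSpace 0 (y : E3)) *
      nullCovector a (E4.ofTimeSpace 0 (y : E3)) (E4.spaceEmbed w) ^ 2 :=
    mul_nonneg (mul_nonneg zero_le_two (scalarH_nonneg hM a _)) (sq_nonneg _)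
  have h3 : 0 < bilin M a (E4.ofTimeSpace 0 (y : E3)) (E4.spaceEmbed w) (E4.spaceEmbed w) := by
    rw [bilin_spaceEmbed_spaceEmbed]; linarith
  exact h3

/-- `g(c V, w) = −c w⁰` on the Kerr–Schild chart (`g(V, ·) = −dt*`). Dafermos–Rodnianski
arXiv:0811.0354, §5.1. [folklore] -/
theorem bilin_smul_timeVector {M a : ℝ} {x : E4} (hx : 0 < radius a x) (c : ℝ) (w : E4) :
    bilin M a x (c • timeVector M a x) w = -(c * w 0) := by
  rw [map_smul, FunLike.coe_smul, Pi.smul_apply, bilin_timeVector hx, smul_eq_mul,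
    mul_neg]

/-- `g(c V, c V) = −c² (1 + 2H)`. Dafermos–Rodnianski arXiv:0811.0354, §5.1. [folklore] -/
theorem bilin_smul_timeVector_smul_timeVector {M a : ℝ} {x : E4} (hx : 0 < radius a x) (c : ℝ) :
    bilin M a x (c • timeVector M a x) (c • timeVector M a x) =
      -(c ^ 2 * (1 + 2 * scalarH M a x)) := by
  rw [bilin_smul_timeVector hx, timeVector]
  simp [nullVector, nullCovectorFun]
  ring

/-- The normalised normal `ν = (1 + 2H)^{-1/2} V` of the Kerr–Schild slice satisfies
`g(ν, ν) = −1` and `g(V, ν) = −(1 + 2H)^{1/2}` wherever `1 + 2H > 0`. Cook 2000, §3.2.2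
(lapse `α = (1 + 2H)^{-1/2}`). [cite: Cook2000, §3.2.2] -/
theorem bilin_sliceNormal_aux {M a : ℝ} {x : E4} (hx : 0 < radius a x)
    (hpos : 0 < 1 + 2 * scalarH M a x) :
    bilin M a x ((√(1 + 2 * scalarH M a x))⁻¹ • timeVector M a x)
        ((√(1 + 2 * scalarH M a x))⁻¹ • timeVector M a x) = -1 ∧
      bilin M a x (timeVector M a x) ((√(1 + 2 * scalarH M a x))⁻¹ • timeVector M a x) =
        -√(1 + 2 * scalarH M a x) := by
  have hs : √(1 + 2 * scalarH M a x) ^ 2 = 1 + 2 * scalarH M a x := Real.sq_sqrt hpos.le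
  have hs0 : √(1 + 2 * scalarH M a x) ≠ 0 := (Real.sqrt_pos.2 hpos).ne'
  have hV0 : timeVector M a x 0 = 1 + 2 * scalarH M a x := by
    simp only [timeVector, PiLp.sub_apply, PiLp.smul_apply, smul_eq_mul, nullVector_apply_zero,
      PiLp.single_apply, if_true]
    ring
  set s : ℝ := 1 + 2 * scalarH M a x with hs_def
  have h1 : (√s)⁻¹ ^ 2 * s = 1 := by
    rw [inv_pow, hs]
    field_simp
  have h2 : (√s)⁻¹ * s = √s := by
    rw [inv_mul_eq_iff_eq_mul₀ hs0, ← sq, hs]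
  constructor
  · rw [bilin_smul_timeVector_smul_timeVector hx]
    linear_combination -h1
  · rw [bilin_timeVector hx, PiLp.smul_apply, smul_eq_mul, hV0, h2]

/-- **Discharge of the named fact `Kerr.isFutureUnitNormal_sliceNormal`**: for `M ≥ 0`,
`ν = (1 + 2H)^{-1/2} V` is the future unit normal of the Kerr–Schild slice:
`g(ν, (0, v)) = −(1 + 2H)^{-1/2} dt*(0, v) = 0`, `g(ν, ν) = (−1 − 2H)/(1 + 2H) = −1`,
`g(V, ν) = −(1 + 2H)^{1/2} < 0`. Cook 2000, §3.2.2; Wald 1984, §10.2. [cite: Cook2000, §3.2.2] -/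
theorem isFutureUnitNormal_sliceNormal_holds [Facts] (M a r₀ : ℝ) :
    isFutureUnitNormal_sliceNormal M a r₀ := by
  intro hM
  have key : ∀ y : slice a r₀,
      0 < radius a (E4.ofTimeSpace 0 (y : E3)) ∧
        0 < 1 + 2 * scalarH M a (E4.ofTimeSpace 0 (y : E3)) := fun y ↦
    ⟨radius_pos_of_mem_region (mem_slice_iff_ofTimeSpace_mem_region.1 y.2), by
      linarith [scalarH_nonneg hM a (E4.ofTimeSpace 0 (y : E3))]⟩
  have hunit : ∀ y : slice a r₀,
      (smoothMetric M a r₀).val (sliceEmbed a r₀ y) (sliceNormal M a r₀ y) (sliceNormal M a r₀ y) =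
        -1 := fun y ↦ by
    obtain ⟨hr, hpos⟩ := key y
    rw [smoothMetric_val, coe_sliceEmbed, sliceNormal_apply]
    exact (bilin_sliceNormal_aux hr hpos).1
  have hVν : ∀ y : slice a r₀,
      (smoothMetric M a r₀).val (sliceEmbed a r₀ y) (timeVector M a (E4.ofTimeSpace 0 (y : E3)))
        (sliceNormal M a r₀ y) < 0 := fun y ↦ by
    obtain ⟨hr, hpos⟩ := key y
    rw [smoothMetric_val, coe_sliceEmbed, sliceNormal_apply]
    have h := (bilin_sliceNormal_aux hr hpos).2
    have hlt : -√(1 + 2 * scalarH M a (E4.ofTimeSpace 0 (y : E3))) < 0 :=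
      neg_neg_of_pos (Real.sqrt_pos.2 hpos)
    exact h ▸ hlt
  refine ⟨⟨fun y v ↦ ?_, hunit⟩, fun y ↦ ⟨?_, ?_⟩⟩
  · -- normal
    obtain ⟨hr, _⟩ := key y
    rw [mfderiv_sliceEmbed, smoothMetric_val, coe_sliceEmbed, sliceNormal_apply]
    have h : bilin M a (E4.ofTimeSpace 0 (y : E3))
        ((√(1 + 2 * scalarH M a (E4.ofTimeSpace 0 (y : E3))))⁻¹ •
          timeVector M a (E4.ofTimeSpace 0 (y : E3))) (E4.spaceEmbed v) = 0 := by
      rw [bilin_smul_timeVector hr]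
      simp
    exact h
  · -- causal
    have ht : (smoothMetric M a r₀).IsTimelike (sliceNormal M a r₀ y) := by
      rw [LorentzianMetric.isTimelike_iff, hunit y]
      norm_num
    exact ht.isCausal
  · -- future
    rw [TimeOrientation.vectorField_ofLE]
    exact hVν y

/-! ### The Boyer–Lindquist function `Σ` and the gradient of the Kerr–Schild radius -/

/-- `Σ(y) := 2 r² − ‖y‖² + a²` on the spatial coordinate space, `r = r(0, y)` the Kerr–Schild
radius; by the defining quartic `r² Σ = r⁴ + a² z²` (`sq_mul_blSigma`), i.e.
`Σ = r² + a² z²/r² = r² + a² cos²θ` (`z = r cos θ`): the Boyer–Lindquist function `Σ` (`ρ²` in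
DRSR arXiv:1402.7034, §2.1.1) written in Kerr–Schild Cartesian coordinates. [cite: DafermosRodnianskiShlapentokhrothman2014, §2.1.1] -/
def blSigma (a : ℝ) (y : E3) : ℝ :=
  2 * radius a (E4.ofTimeSpace 0 y) ^ 2 - ‖y‖ ^ 2 + a ^ 2

/-- The defining quartic on the slice: `r⁴ − (‖y‖² − a²) r² − a² z² = 0`, `z = y₂`
(Visser arXiv:0706.0622, (35)). [cite: arXiv07060622, (35)] -/
theorem radius_slice_quartic (a : ℝ) (y : E3) :
    radius a (E4.ofTimeSpace 0 y) ^ 4 - (‖y‖ ^ 2 - a ^ 2) * radius a (E4.ofTimeSpace 0 y) ^ 2 -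
      a ^ 2 * y 2 ^ 2 = 0 := by
  have h := radius_quartic a (E4.ofTimeSpace 0 y)
  have h3 : (E4.ofTimeSpace 0 y) 3 = y 2 := E4.ofTimeSpace_apply_succ 0 y 2
  rwa [E4.spatialNorm_ofTimeSpace, h3] at h

/-- `r² Σ = r⁴ + a² z²` (Visser arXiv:0706.0622, (33)–(35): the denominator of `H`). [cite: arXiv07060622, (33)–(35)] -/
theorem sq_mul_blSigma (a : ℝ) (y : E3) :
    radius a (E4.ofTimeSpace 0 y) ^ 2 * blSigma a y =
      radius a (E4.ofTimeSpace 0 y) ^ 4 + a ^ 2 * y 2 ^ 2 := by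
  unfold blSigma
  linear_combination radius_slice_quartic a y

/-- `Σ > 0` wherever `r > 0`. [folklore] -/
theorem blSigma_pos {a : ℝ} {y : E3} (hr : 0 < radius a (E4.ofTimeSpace 0 y)) :
    0 < blSigma a y := by
  have h := sq_mul_blSigma a y
  have h4 : 0 < radius a (E4.ofTimeSpace 0 y) ^ 4 + a ^ 2 * y 2 ^ 2 := by positivity
  by_contra hle
  have : radius a (E4.ofTimeSpace 0 y) ^ 2 * blSigma a y ≤ 0 :=
    mul_nonpos_of_nonneg_of_nonpos (sq_nonneg _) (not_lt.mp hle)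
  linarith

/-- `r² ≤ Σ` (`Σ − r² = a² z²/r² ≥ 0`). [folklore] -/
theorem sq_le_blSigma {a : ℝ} {y : E3} (hr : 0 < radius a (E4.ofTimeSpace 0 y)) :
    radius a (E4.ofTimeSpace 0 y) ^ 2 ≤ blSigma a y := by
  have h := sq_mul_blSigma a y
  have hr2 : 0 < radius a (E4.ofTimeSpace 0 y) ^ 2 := by positivity
  refine le_of_mul_le_mul_left ?_ hr2
  rw [h]
  nlinarith [sq_nonneg (a * y 2)]

/-- `‖y‖² = y₀² + y₁² + y₂²` on `E3`. [folklore] -/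
theorem _root_.Literature.Geometry.Lorentzian.E3.norm_sq (y : E3) : ‖y‖ ^ 2 = y 0 ^ 2 + y 1 ^ 2 + y 2 ^ 2 := by
  rw [EuclideanSpace.real_norm_sq_eq]
  simp [Fin.sum_univ_three]

/-- The Kerr–Schild scalar in terms of `Σ`: `H = M r³/(r⁴ + a² z²) = M r/Σ` at every point
`(t, y)` with `r > 0` (Visser arXiv:0706.0622, (33)). [cite: arXiv07060622, (33)] -/
theorem scalarH_ofTimeSpace_eq {M a : ℝ} (t : ℝ) {y : E3} (hr : 0 < radius a (E4.ofTimeSpace 0 y)) :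
    scalarH M a (E4.ofTimeSpace t y) = M * radius a (E4.ofTimeSpace 0 y) / blSigma a y := by
  have hS := blSigma_pos hr
  have h := sq_mul_blSigma a y
  have h3 : (E4.ofTimeSpace t y) 3 = y 2 := E4.ofTimeSpace_apply_succ t y 2
  rw [scalarH, radius_ofTimeSpace, h3, ← h]
  have hr0 : radius a (E4.ofTimeSpace 0 y) ≠ 0 := hr.ne'
  field_simp

/-- The **spatial gradient vector of the Kerr–Schild radius**,
`∇r = (r² y + a² z e_z)/(r Σ)`, obtained by differentiating the quartic
`r⁴ − (‖y‖² − a²) r² − a² z² = 0` (Visser arXiv:0706.0622, (35)). [folklore] -/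
def radiusGradVec (a : ℝ) (y : E3) : E3 :=
  (radius a (E4.ofTimeSpace 0 y) * blSigma a y)⁻¹ •
    (radius a (E4.ofTimeSpace 0 y) ^ 2 • y + (a ^ 2 * y 2) • EuclideanSpace.single 2 1)

/-- Components of `∇r`: `∂_i r = (r² y_i + a² z δ_{i2})/(r Σ)`. [folklore] -/
theorem radiusGradVec_apply (a : ℝ) (y : E3) (i : Fin 3) :
    radiusGradVec a y i =
      (radius a (E4.ofTimeSpace 0 y) ^ 2 * y i + if i = 2 then a ^ 2 * y 2 else 0) /
        (radius a (E4.ofTimeSpace 0 y) * blSigma a y) := by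
  simp only [radiusGradVec, PiLp.smul_apply, PiLp.add_apply, smul_eq_mul, PiLp.single_apply,
    mul_ite, mul_one, mul_zero]
  rw [div_eq_inv_mul]

/-- The spatial gradient of the Kerr–Schild radius as a covector, `dr = ⟨∇r, ·⟩`. [folklore] -/
def radiusGrad (a : ℝ) (y : E3) : E3 →L[ℝ] ℝ :=
  innerSL ℝ (radiusGradVec a y)

/-- `dr(v) = ⟨∇r, v⟩`. [folklore] -/
@[simp]
theorem radiusGrad_apply (a : ℝ) (y v : E3) : radiusGrad a y v = ⟪radiusGradVec a y, v⟫ :=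
  rfl

/-- `dr(v) = (r² ⟨y, v⟩ + a² z v₂)/(r Σ)`. [folklore] -/
theorem radiusGrad_apply_eq (a : ℝ) (y v : E3) :
    radiusGrad a y v =
      (radius a (E4.ofTimeSpace 0 y) ^ 2 * ⟪y, v⟫ + a ^ 2 * y 2 * v 2) /
        (radius a (E4.ofTimeSpace 0 y) * blSigma a y) := by
  rw [radiusGrad_apply, radiusGradVec, real_inner_smul_left, inner_add_left,
    real_inner_smul_left, real_inner_smul_left, div_eq_inv_mul]
  congr 2
  rw [EuclideanSpace.inner_single_left]
  simp

/-- **The Kerr–Schild radius is differentiable off the disc, with gradient `radiusGrad`**: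
differentiate the quartic `r⁴ − (‖y‖² − a²) r² − a² z² = 0` (whose `r`-derivative
`4r³ − 2r(‖y‖² − a²) = 2rΣ` does not vanish) and solve for `dr`. Visser arXiv:0706.0622, (35);
Kerr–Schild 1965, §3 (`r` is real-analytic off the disc). [cite: arXiv07060622, (35)] -/
theorem hasFDerivAt_radius_slice {a : ℝ} {y : E3} (hr : 0 < radius a (E4.ofTimeSpace 0 y)) :
    HasFDerivAt (fun y : E3 ↦ radius a (E4.ofTimeSpace 0 y)) (radiusGrad a y) y := by
  -- differentiability from the explicit formula
  have hd : DifferentiableAt ℝ (fun y : E3 ↦ radius a (E4.ofTimeSpace 0 y)) y := by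
    have h1 : ContDiffAt ℝ 1 (radius a) (E4.ofTimeSpace 0 y) := contDiffAt_radius hr
    have h2 : DifferentiableAt ℝ (E4.ofTimeSpace 0) y :=
      (E4.hasFDerivAt_ofTimeSpace 0 y).differentiableAt
    exact (h1.differentiableAt one_ne_zero).comp y h2
  set φ : E3 → ℝ := fun y ↦ radius a (E4.ofTimeSpace 0 y) with hφdef
  set φ' : E3 →L[ℝ] ℝ := fderiv ℝ φ y
  have hφ : HasFDerivAt φ φ' y := hd.hasFDerivAt
  set r := φ y with hrdef
  -- derivative of the quartic expression
  set F : E3 → ℝ := fun y' ↦ φ y' ^ 4 - (‖y'‖ ^ 2 - a ^ 2) * φ y' ^ 2 - a ^ 2 * y' 2 ^ 2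
    with hFdef
  have hF0 : HasFDerivAt F (0 : E3 →L[ℝ] ℝ) y := by
    have : F = fun _ ↦ 0 := funext fun y' ↦ radius_slice_quartic a y'
    rw [this]
    exact hasFDerivAt_const 0 y
  have hnorm : HasFDerivAt (fun y' : E3 ↦ ‖y'‖ ^ 2) (2 • (innerSL ℝ y : E3 →L[ℝ] ℝ)) y :=
    (hasStrictFDerivAt_norm_sq y).hasFDerivAt
  have hproj : HasFDerivAt (fun y' : E3 ↦ y' 2) (EuclideanSpace.proj 2 : E3 →L[ℝ] ℝ) y :=
    (EuclideanSpace.proj (𝕜 := ℝ) (2 : Fin 3)).hasFDerivAt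
  have hF : HasFDerivAt F
      ((4 * r ^ 3 - (‖y‖ ^ 2 - a ^ 2) * (2 * r)) • φ' - r ^ 2 • (2 • (innerSL ℝ y : E3 →L[ℝ] ℝ))
        - (a ^ 2 * (2 * y 2)) • (EuclideanSpace.proj 2 : E3 →L[ℝ] ℝ)) y := by
    have h4 := hφ.pow 4
    have h2 := hφ.pow 2
    have hA := (hnorm.sub_const (a ^ 2)).mul h2
    have hB := (hproj.pow 2).const_mul (a ^ 2)
    refine ((h4.sub hA).sub hB).congr_fderiv ?_
    ext v
    simp only [FunLike.coe_sub, FunLike.coe_smul, Pi.sub_apply, Pi.smul_apply, smul_eq_mul,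
      _root_.add_apply, nsmul_eq_mul, Nat.cast_ofNat, Pi.mul_apply, Pi.ofNat_apply]
    ring
  have hzero := hF.unique hF0
  -- solve the linear equation for φ'
  have hSig : blSigma a y = 2 * r ^ 2 - ‖y‖ ^ 2 + a ^ 2 := rfl
  have hc : (4 * r ^ 3 - (‖y‖ ^ 2 - a ^ 2) * (2 * r)) = 2 * (r * blSigma a y) := by
    rw [hSig]; ring
  have hne : r * blSigma a y ≠ 0 := mul_ne_zero hr.ne' (blSigma_pos hr).ne'
  have key : φ' = radiusGrad a y := by
    ext v
    have := congrArg (fun L : E3 →L[ℝ] ℝ ↦ L v) hzero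
    simp only [FunLike.coe_sub, FunLike.coe_smul, Pi.sub_apply, Pi.smul_apply, smul_eq_mul,
      _root_.zero_apply, nsmul_eq_mul, Nat.cast_ofNat, Pi.mul_apply, Pi.ofNat_apply,
      innerSL_apply_apply, PiLp.proj_apply] at this
    rw [radiusGrad_apply_eq, eq_div_iff hne]
    rw [hc] at this
    linear_combination (1 / 2 : ℝ) * this
  rw [← key]
  exact hφ

/-- The same at any time: `y ↦ r(t, y)` has gradient `radiusGrad a y` (the radius does not depend
on `t*`). [folklore] -/
theorem hasFDerivAt_radius_ofTimeSpace {a : ℝ} (t : ℝ) {y : E3}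
    (hr : 0 < radius a (E4.ofTimeSpace 0 y)) :
    HasFDerivAt (fun y : E3 ↦ radius a (E4.ofTimeSpace t y)) (radiusGrad a y) y := by
  have : (fun y : E3 ↦ radius a (E4.ofTimeSpace t y)) = fun y ↦ radius a (E4.ofTimeSpace 0 y) :=
    funext fun y ↦ radius_ofTimeSpace a t y
  rw [this]
  exact hasFDerivAt_radius_slice hr

/-- `y ↦ r(0, y)` is `C^n` (every `n ≤ ω`) wherever it is positive. Kerr–Schild 1965, §3. [cite: KerrSchild1965, §3] -/
theorem contDiffAt_radius_slice {a : ℝ} {y : E3} (hr : 0 < radius a (E4.ofTimeSpace 0 y))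
    {n : WithTop ℕ∞} : ContDiffAt ℝ n (fun y : E3 ↦ radius a (E4.ofTimeSpace 0 y)) y :=
  (contDiffAt_radius hr).comp y (E4.contDiff_ofTimeSpace 0).contDiffAt

/-! ### `ℓ⃗ · ∇r = 1` and `|∇r|² = (r² + a²)/Σ` -/

/-- The spatial part `ℓ⃗ = (ℓ₁, ℓ₂, ℓ₃)` of the Kerr–Schild null vector at `x`, as a vector of
`E3` (Visser arXiv:0706.0622, (34)). [cite: arXiv07060622, (34)] -/
def nullSpatial (a : ℝ) (x : E4) : E3 :=
  E4.spatial (nullVector a x)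

/-- Components: `(ℓ⃗)_i = ℓ_{i+1}`. [folklore] -/
@[simp]
theorem nullSpatial_apply (a : ℝ) (x : E4) (i : Fin 3) :
    nullSpatial a x i = nullCovectorFun a x i.succ := by
  simp only [nullSpatial, E4.spatial_apply]
  fin_cases i
  · exact nullVector_apply_one a x
  · exact nullVector_apply_two a x
  · exact nullVector_apply_three a x

/-- `ℓ⃗ · y = r` at the point `(t, y)`: `(r(y₀² + y₁²))/(r² + a²) + y₂²/r = r` by the quartic
(Visser arXiv:0706.0622, (34)–(35)). [cite: arXiv07060622, (34)–(35)] -/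
theorem inner_nullSpatial_self {a : ℝ} (t : ℝ) {y : E3}
    (hr : 0 < radius a (E4.ofTimeSpace 0 y)) :
    ⟪nullSpatial a (E4.ofTimeSpace t y), y⟫ = radius a (E4.ofTimeSpace 0 y) := by
  have hq := radius_slice_quartic a y
  rw [E3.norm_sq] at hq
  set r := radius a (E4.ofTimeSpace 0 y) with hrdef
  have hr' : radius a (E4.ofTimeSpace t y) = r := radius_ofTimeSpace a t y
  have hra : r ^ 2 + a ^ 2 ≠ 0 := by positivity
  simp only [EuclideanSpace.inner_eq_star_dotProduct, star_trivial, dotProduct,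
    Fin.sum_univ_three, nullSpatial_apply, Fin.succ_zero_eq_one, Fin.succ_one_eq_two,
    fin_succ_two_eq_three, nullCovectorFun, hr', Matrix.cons_val_one, Matrix.cons_val,
    Fin.isValue, Matrix.cons_val_zero]
  simp only [E4.ofTimeSpace, PiLp.toLp_apply, Matrix.cons_val_one, Matrix.cons_val]
  field_simp
  linear_combination (-1 : ℝ) * hq


/-- `ℓ₃ = z/r` at `(t, y)` (`z = y₂`). Visser arXiv:0706.0622, (34). [cite: arXiv07060622, (34)] -/
theorem nullCovectorFun_ofTimeSpace_three (a t : ℝ) (y : E3) :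
    nullCovectorFun a (E4.ofTimeSpace t y) 3 = y 2 / radius a (E4.ofTimeSpace 0 y) := by
  rw [← radius_ofTimeSpace a t y]
  simp [nullCovectorFun, E4.ofTimeSpace]

/-- **`ℓ⃗ · ∇r = 1`**: the Kerr–Schild null vector has unit radial component,
`dr(ℓ⃗) = (r² (ℓ⃗·y) + a² z ℓ₃)/(rΣ) = (r³ + a² z²/r)/(rΣ) = 1` (so `t* + r` is constant along
`ℓ♯ = (−1, ℓ⃗)`, which is tangent to the ingoing principal null congruence `{v = const}`).
Visser arXiv:0706.0622, (34)–(35). [cite: arXiv07060622, (34)–(35)] -/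
theorem radiusGrad_nullSpatial {a : ℝ} (t : ℝ) {y : E3} (hr : 0 < radius a (E4.ofTimeSpace 0 y)) :
    radiusGrad a y (nullSpatial a (E4.ofTimeSpace t y)) = 1 := by
  rw [radiusGrad_apply_eq, real_inner_comm, inner_nullSpatial_self t hr, nullSpatial_apply,
    fin_succ_two_eq_three, nullCovectorFun_ofTimeSpace_three, div_eq_one_iff_eq
      (mul_ne_zero hr.ne' (blSigma_pos hr).ne')]
  have h := sq_mul_blSigma a y
  field_simp
  linear_combination (-1 : ℝ) * h

/-- The algebra of `|∇r|²`: with the quartic, `|r² y + a² z e_z|² = (r² + a²) r² Σ`. [folklore] -/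
theorem normSq_radiusGrad_alg (r b y₀ y₁ y₂ : ℝ)
    (hq : r ^ 4 - (y₀ ^ 2 + y₁ ^ 2 + y₂ ^ 2 - b) * r ^ 2 - b * y₂ ^ 2 = 0) :
    (r ^ 2 * y₀) ^ 2 + (r ^ 2 * y₁) ^ 2 + (r ^ 2 * y₂ + b * y₂) ^ 2 =
      (r ^ 2 + b) * (r ^ 2 * (2 * r ^ 2 - (y₀ ^ 2 + y₁ ^ 2 + y₂ ^ 2) + b)) := by
  linear_combination (-(2 * r ^ 2 + b)) * hq

/-- **`|∇r|² = (r² + a²)/Σ`** (the Euclidean norm of the spatial gradient of the Kerr–Schild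
radius; in Boyer–Lindquist terms `η^{rr} = (r² + a²)/Σ` for the flat metric in oblate spheroidal
coordinates). Visser arXiv:0706.0622, (35). [cite: arXiv07060622, (35)] -/
theorem inner_radiusGradVec_self {a : ℝ} {y : E3} (hr : 0 < radius a (E4.ofTimeSpace 0 y)) :
    ⟪radiusGradVec a y, radiusGradVec a y⟫ =
      (radius a (E4.ofTimeSpace 0 y) ^ 2 + a ^ 2) / blSigma a y := by
  have hS := blSigma_pos hr
  have hq := radius_slice_quartic a y
  rw [E3.norm_sq] at hq
  have halg := normSq_radiusGrad_alg _ _ _ _ _ hq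
  rw [real_inner_self_eq_norm_sq, E3.norm_sq, radiusGradVec_apply, radiusGradVec_apply,
    radiusGradVec_apply]
  simp only [Fin.isValue, Fin.reduceEq, ↓reduceIte, add_zero]
  rw [div_pow, div_pow, div_pow, ← add_div, ← add_div, div_eq_div_iff (by positivity) hS.ne',
    halg, blSigma, E3.norm_sq]
  ring

/-! ### Derivatives of the cut-off profiles and heights -/

section Profile

open MeasureTheory

/-- The integrand `s ↦ χ((s − R₁)/R₁) σ(s)` of `cutoffProfile` is continuous where `σ` is.
[folklore] -/
theorem continuousOn_cutoffIntegrand {σ : ℝ → ℝ} {S : Set ℝ} (hσ : ContinuousOn σ S) (R₁ : ℝ) :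
    ContinuousOn (fun s ↦ Real.smoothTransition ((s - R₁) / R₁) * σ s) S :=
  ((Real.smoothTransition.continuous.comp
    ((continuous_sub_right R₁).div_const R₁)).continuousOn).mul hσ

/-- **`k' = χ((r − R₁)/R₁) σ(r)`**: the cut-off profile `k(r) = ∫_{R₁}^r χ((s − R₁)/R₁) σ(s) ds`
is differentiable at every `r` of an open interval `(ρ, ∞)` containing `R₁` on which `σ` is
continuous (fundamental theorem of calculus). DRSR arXiv:1402.7034, p. 51. [folklore] -/
theorem hasDerivAt_cutoffProfile {σ : ℝ → ℝ} {ρ R₁ r : ℝ} (hσ : ContinuousOn σ (Ioi ρ))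
    (hR : ρ < R₁) (hr : ρ < r) :
    HasDerivAt (cutoffProfile σ R₁) (Real.smoothTransition ((r - R₁) / R₁) * σ r) r := by
  have hc := continuousOn_cutoffIntegrand hσ R₁
  have hsub : uIcc R₁ r ⊆ Ioi ρ := ordConnected_Ioi.uIcc_subset hR hr
  have h1 : IntervalIntegrable (fun s ↦ Real.smoothTransition ((s - R₁) / R₁) * σ s) volume R₁ r :=
    (hc.mono hsub).intervalIntegrable
  have h2 := hc.stronglyMeasurableAtFilter (μ := volume) isOpen_Ioi r hr
  have h3 : ContinuousAt (fun s ↦ Real.smoothTransition ((s - R₁) / R₁) * σ s) r :=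
    hc.continuousAt (isOpen_Ioi.mem_nhds hr)
  exact intervalIntegral.integral_hasDerivAt_right h1 h2 h3

/-- The cut-off profile is differentiable on `(ρ, ∞)` with derivative `χ((r − R₁)/R₁) σ(r)`.
[folklore] -/
theorem deriv_cutoffProfile {σ : ℝ → ℝ} {ρ R₁ r : ℝ} (hσ : ContinuousOn σ (Ioi ρ))
    (hR : ρ < R₁) (hr : ρ < r) :
    deriv (cutoffProfile σ R₁) r = Real.smoothTransition ((r - R₁) / R₁) * σ r :=
  (hasDerivAt_cutoffProfile hσ hR hr).deriv

/-- **The cut-off profile is `C^∞` on `(ρ, ∞)` when `σ` is**: its derivative is the `C^∞`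
integrand. [folklore] -/
theorem contDiffOn_cutoffProfile {σ : ℝ → ℝ} {ρ R₁ : ℝ} (hσ : ContDiffOn ℝ ∞ σ (Ioi ρ))
    (hR : ρ < R₁) : ContDiffOn ℝ ∞ (cutoffProfile σ R₁) (Ioi ρ) := by
  rw [contDiffOn_infty_iff_deriv_of_isOpen isOpen_Ioi]
  refine ⟨fun r hr ↦ (hasDerivAt_cutoffProfile hσ.continuousOn hR hr).differentiableAt
    |>.differentiableWithinAt, ?_⟩
  have hint : ContDiffOn ℝ ∞ (fun s ↦ Real.smoothTransition ((s - R₁) / R₁) * σ s) (Ioi ρ) :=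
    ((Real.smoothTransition.contDiff.comp
      ((contDiff_id.sub contDiff_const).div_const R₁)).contDiffOn).mul hσ
  exact hint.congr fun r hr ↦ deriv_cutoffProfile hσ.continuousOn hR hr

/-- **`dh = k'(r) dr`**: the cut-off height `h = k ∘ r(0, ·)` has differential
`χ((r − R₁)/R₁) σ(r) · dr` at every `y` with `r(0, y) > ρ ≥ 0` (chain rule with
`hasFDerivAt_radius_slice`). DRSR arXiv:1402.7034, §3.3 and p. 51. [folklore] -/
theorem hasFDerivAt_cutoffHeight {σ : ℝ → ℝ} {a ρ R₁ : ℝ} {y : E3} (hρ : 0 ≤ ρ)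
    (hσ : ContinuousOn σ (Ioi ρ)) (hR : ρ < R₁) (hy : ρ < radius a (E4.ofTimeSpace 0 y)) :
    HasFDerivAt (cutoffHeight σ a R₁)
      ((Real.smoothTransition ((radius a (E4.ofTimeSpace 0 y) - R₁) / R₁) *
          σ (radius a (E4.ofTimeSpace 0 y))) • radiusGrad a y) y :=
  (hasDerivAt_cutoffProfile hσ hR hy).comp_hasFDerivAt y
    (hasFDerivAt_radius_slice (hρ.trans_lt hy))

/-- The cut-off height is `C^∞` on the slice `{r(0, ·) > ρ}` (`ρ ≥ 0`) when `σ` is `C^∞` on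
`(ρ, ∞)`. [folklore] -/
theorem contDiffOn_cutoffHeight {σ : ℝ → ℝ} {a ρ R₁ : ℝ} (hρ : 0 ≤ ρ)
    (hσ : ContDiffOn ℝ ∞ σ (Ioi ρ)) (hR : ρ < R₁) :
    ContDiffOn ℝ ∞ (cutoffHeight σ a R₁) {y : E3 | ρ < radius a (E4.ofTimeSpace 0 y)} := by
  intro y hy
  have h1 : ContDiffWithinAt ℝ ∞ (cutoffProfile σ R₁) (Ioi ρ) (radius a (E4.ofTimeSpace 0 y)) :=
    contDiffOn_cutoffProfile hσ hR _ hy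
  have h2 : ContDiffWithinAt ℝ ∞ (fun y : E3 ↦ radius a (E4.ofTimeSpace 0 y))
      {y : E3 | ρ < radius a (E4.ofTimeSpace 0 y)} y :=
    (contDiffAt_radius_slice (hρ.trans_lt hy)).contDiffWithinAt
  exact h1.comp y h2 fun y' hy' ↦ hy'

end Profile

/-! ### The conormal of a radial graph leaf: `ν(ℓ♯)`, `η⁻¹(ν, ν)`, `g⁻¹(ν, ν)`, `ν(V)` -/

/-- `spatial ∂₀ = 0`. [folklore] -/
@[simp]
theorem _root_.Literature.Geometry.Lorentzian.E4.spatial_basisVector_zero : E4.spatial (E4.basisVector 0) = 0 := by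
  ext i
  simp [Fin.succ_ne_zero]

/-- `spatial ∂_{i+1} = e_i`. [folklore] -/
@[simp]
theorem _root_.Literature.Geometry.Lorentzian.E4.spatial_basisVector_succ (i : Fin 3) :
    E4.spatial (E4.basisVector i.succ) = EuclideanSpace.single i 1 := by
  ext j
  simp [PiLp.single_apply, Fin.succ_inj]

/-- `spatial ∂₁ = e₀`. [folklore] -/
@[simp]
theorem _root_.Literature.Geometry.Lorentzian.E4.spatial_basisVector_one :
    E4.spatial (E4.basisVector 1) = EuclideanSpace.single 0 1 :=
  E4.spatial_basisVector_succ 0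

/-- `spatial ∂₂ = e₁`. [folklore] -/
@[simp]
theorem _root_.Literature.Geometry.Lorentzian.E4.spatial_basisVector_two :
    E4.spatial (E4.basisVector 2) = EuclideanSpace.single 1 1 :=
  E4.spatial_basisVector_succ 1

/-- `spatial ∂₃ = e₂`. [folklore] -/
@[simp]
theorem _root_.Literature.Geometry.Lorentzian.E4.spatial_basisVector_three :
    E4.spatial (E4.basisVector 3) = EuclideanSpace.single 2 1 :=
  E4.spatial_basisVector_succ 2

/-- `dr(e_i) = (∇r)_i`. [folklore] -/
theorem radiusGrad_single (a : ℝ) (y : E3) (i : Fin 3) :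
    radiusGrad a y (EuclideanSpace.single i 1) = radiusGradVec a y i := by
  rw [radiusGrad_apply, EuclideanSpace.inner_single_right]
  simp

section Conormal

variable {M a t c : ℝ} {h : E3 → ℝ} {y : E3}

/-- For a height function with radial differential `dh_y = c · dr`, the leaf conormal
`ν = dt* − dh` at `(t, y)` evaluates on `w` to `w⁰ − c · dr(w⃗)`. [folklore] -/
theorem leafConormal_apply_of_radial (hh : fderiv ℝ h y = c • radiusGrad a y) (w : E4) :
    leafConormal h (E4.ofTimeSpace t y) w = w 0 - c * radiusGrad a y (E4.spatial w) := by
  rw [leafConormal_apply, E4.spatial_ofTimeSpace, hh]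
  rfl

/-- **`ν(ℓ♯) = −(1 + c)`** for `dh = c · dr` (`(ℓ♯)⁰ = −1`, `dr(ℓ⃗) = 1`). [folklore] -/
theorem leafConormal_nullVector_of_radial (hh : fderiv ℝ h y = c • radiusGrad a y)
    (hr : 0 < radius a (E4.ofTimeSpace 0 y)) :
    leafConormal h (E4.ofTimeSpace t y) (nullVector a (E4.ofTimeSpace t y)) = -(1 + c) := by
  rw [leafConormal_apply_of_radial hh, nullVector_apply_zero, ← nullSpatial,
    radiusGrad_nullSpatial t hr]
  ring

/-- **`η⁻¹(ν, ν) = −1 + c² |∇r|² = −1 + c² (r² + a²)/Σ`** for `dh = c · dr`. [folklore] -/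
theorem leafConormal_etaSharp_of_radial (hh : fderiv ℝ h y = c • radiusGrad a y)
    (hr : 0 < radius a (E4.ofTimeSpace 0 y)) :
    leafConormal h (E4.ofTimeSpace t y) (etaSharp (leafConormal h (E4.ofTimeSpace t y))) =
      -1 + c ^ 2 * ((radius a (E4.ofTimeSpace 0 y) ^ 2 + a ^ 2) / blSigma a y) := by
  rw [apply_etaSharp, ← inner_radiusGradVec_self hr, real_inner_self_eq_norm_sq, E3.norm_sq]
  simp only [leafConormal_apply_of_radial hh, E4.spatial_basisVector_zero,
    E4.spatial_basisVector_one, E4.spatial_basisVector_two, E4.spatial_basisVector_three,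
    radiusGrad_single, map_zero, mul_zero, sub_zero, PiLp.single_apply, Fin.reduceEq, if_true,
    if_false, zero_sub, one_pow]
  ring

/-- **`g⁻¹(ν, ν) = (−Σ + c²(r² + a²) − 2Mr(1 + c)²)/Σ`** for `dh = c · dr`, from
`g⁻¹ = η⁻¹ − 2H ℓ♯ ⊗ ℓ♯`, `H = Mr/Σ`, `ν(ℓ♯) = −(1 + c)`, `η⁻¹(ν,ν) = −1 + c²(r² + a²)/Σ`
(Kerr–Schild 1965, §2; Visser arXiv:0706.0622, §5). This is the quantity whose sign decides
whether the leaf is spacelike. [cite: KerrSchild1965, §2] -/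
theorem leafConormal_coSharp_of_radial (hh : fderiv ℝ h y = c • radiusGrad a y)
    (hr : 0 < radius a (E4.ofTimeSpace 0 y)) :
    leafConormal h (E4.ofTimeSpace t y)
        (coSharp M a (E4.ofTimeSpace t y) (leafConormal h (E4.ofTimeSpace t y))) =
      (-blSigma a y + c ^ 2 * (radius a (E4.ofTimeSpace 0 y) ^ 2 + a ^ 2) -
          2 * M * radius a (E4.ofTimeSpace 0 y) * (1 + c) ^ 2) / blSigma a y := by
  have hS := blSigma_pos hr
  rw [coSharp, map_sub, map_smul, leafConormal_etaSharp_of_radial hh hr,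
    leafConormal_nullVector_of_radial hh hr, scalarH_ofTimeSpace_eq t hr, smul_eq_mul]
  field_simp

/-- **`ν(V) = 1 + 2H(1 + c)`** for `dh = c · dr` and the Kerr–Schild field
`V = ∂_{t*} − 2H ℓ♯`: `ν(∂_{t*}) = 1`, `ν(ℓ♯) = −(1 + c)`. [folklore] -/
theorem leafConormal_timeVector_of_radial (hh : fderiv ℝ h y = c • radiusGrad a y)
    (hr : 0 < radius a (E4.ofTimeSpace 0 y)) :
    leafConormal h (E4.ofTimeSpace t y) (timeVector M a (E4.ofTimeSpace t y)) =
      1 + 2 * scalarH M a (E4.ofTimeSpace t y) * (1 + c) := by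
  rw [timeVector, map_sub, map_smul, leafConormal_nullVector_of_radial hh hr,
    leafConormal_apply_of_radial hh, E4.spatial_basisVector_zero, map_zero, smul_eq_mul]
  simp only [PiLp.single_apply, if_true, mul_zero, sub_zero]
  ring

end Conormal


/-! ### The sign of `g⁻¹(ν, ν)`: slopes between the Kerr–Schild slice and `scriSlope` are spacelike

With `dh = c · dr`, `Σ · g⁻¹(ν, ν) = −Σ + P(c)`,
`P(c) := c²(r² + a²) − 2Mr(1 + c)² = c²Δ − 4Mrc − 2Mr` (`Δ = r² − 2Mr + a²`), a convex function
of `c` with `P(0) = −2Mr < 0`. Since `Σ ≥ r²`, the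
leaf is spacelike at radius `r` as soon as `P(c) < r²`; for `c` between `0` (the Kerr–Schild
slice) and the far slope `σ♯(r) = scriSlope M a r` this holds for `r ≥ 2M`, because
`P(σ♯(r)) < r²` there (`r²Δ (r² − P(σ♯)) = −N`, `N = u² − r³u − 4M²r⁴ < 0`,
`u = Δ(r + 2M) = r³ + (a² − 4M²) r + 2Ma²`). In Boyer–Lindquist terms this is the statement of
the module docstring of `KerrHyperboloidalFlux.lean` (*The corrected foliation*, (ii)) that the
`t`-slopes `−2Mr/Δ` (Kerr–Schild slice) and `1 + 2M/r` (far leaf) both lie in the spacelike range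
`|G'| < ((r² + a²)² − a²Δ sin²θ)^{1/2}/Δ`. -/

/-- `P(c) = c²(r² + a²) − 2Mr(1 + c)² = c²(r² − 2Mr + a²) − 4Mrc − 2Mr`. [folklore] -/
theorem leafQuadratic_eq (M a r c : ℝ) :
    c ^ 2 * (r ^ 2 + a ^ 2) - 2 * M * r * (1 + c) ^ 2 =
      c ^ 2 * (r ^ 2 - 2 * M * r + a ^ 2) - 4 * M * r * c - 2 * M * r := by
  ring

/-- The quartic inequality behind the spacelikeness of the far leaves: for `0 < M`, `0 ≤ b < M²`
(`b = a²`) and `r ≥ 2M`,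
`N = (b − 8M²) r⁴ + 2Mb r³ + (b − 4M²)² r² + 4Mb(b − 4M²) r + 4M²b² < 0`
(termwise: `≤ (−7 + 1 + 4 + 0 + ¼) M² r⁴`). [folklore] -/
theorem scri_quartic_neg {M b r : ℝ} (hM : 0 < M) (hb0 : 0 ≤ b) (hb : b < M ^ 2)
    (hr : 2 * M ≤ r) :
    (b - 8 * M ^ 2) * r ^ 4 + 2 * M * b * r ^ 3 + (b - 4 * M ^ 2) ^ 2 * r ^ 2 +
        4 * M * b * (b - 4 * M ^ 2) * r + 4 * M ^ 2 * b ^ 2 < 0 := by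
  have hr0 : 0 < r := by linarith
  have hM2 : 0 < M ^ 2 := by positivity
  have hr4 : 0 < r ^ 4 := by positivity
  have T1 : (b - 8 * M ^ 2) * r ^ 4 ≤ -7 * M ^ 2 * r ^ 4 :=
    mul_le_mul_of_nonneg_right (by linarith) hr4.le
  have T2 : 2 * M * b * r ^ 3 ≤ M ^ 2 * r ^ 4 := by
    have h1 : 2 * M * b * r ^ 3 ≤ 2 * M * M ^ 2 * r ^ 3 := by gcongr
    have h2 : 0 ≤ M ^ 2 * r ^ 3 * (r - 2 * M) :=
      mul_nonneg (by positivity) (by linarith)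
    nlinarith [h1, h2]
  have T3 : (b - 4 * M ^ 2) ^ 2 * r ^ 2 ≤ 4 * M ^ 2 * r ^ 4 := by
    have h1 : (b - 4 * M ^ 2) ^ 2 ≤ 16 * M ^ 4 := by
      nlinarith [mul_nonneg hb0 (by linarith : 0 ≤ 8 * M ^ 2 - b)]
    have h2 : (b - 4 * M ^ 2) ^ 2 * r ^ 2 ≤ 16 * M ^ 4 * r ^ 2 :=
      mul_le_mul_of_nonneg_right h1 (sq_nonneg r)
    have h3 : 4 * M ^ 2 ≤ r ^ 2 := by nlinarith
    have h4 : 0 ≤ 4 * M ^ 2 * r ^ 2 * (r ^ 2 - 4 * M ^ 2) :=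
      mul_nonneg (by positivity) (by linarith)
    nlinarith [h2, h4]
  have T4 : 4 * M * b * (b - 4 * M ^ 2) * r ≤ 0 := by
    have h1 : 0 ≤ 4 * M * b * r * (4 * M ^ 2 - b) :=
      mul_nonneg (by positivity) (by linarith)
    nlinarith [h1]
  have T5 : 4 * M ^ 2 * b ^ 2 ≤ M ^ 2 * r ^ 4 / 4 := by
    have h1 : b ^ 2 ≤ (M ^ 2) ^ 2 := pow_le_pow_left₀ hb0 hb.le 2
    have h2 : (2 * M) ^ 4 ≤ r ^ 4 := pow_le_pow_left₀ (by linarith) hr 4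
    nlinarith [h1, h2, mul_le_mul_of_nonneg_left h1 (by positivity : (0 : ℝ) ≤ 4 * M ^ 2)]
  nlinarith [T1, T2, T3, T4, T5, mul_pos hM2 hr4]

/-- **The far slope is spacelike for `r ≥ 2M`**: `P(σ♯(r)) < r²` for `σ♯ = scriSlope M a`,
`|a| < M`, `r > r₊`, `r ≥ 2M`. With `Δ = (r − r₊)(r − r₋)`, `σ♯ rΔ = w := r(r² + a²) + 2MΔ`
and `(rΔ)² (r² − P(σ♯)) = −Δ N`, `N < 0` the quartic of `scri_quartic_neg`. [folklore] -/
theorem leafQuadratic_scriSlope_lt_sq {M a r : ℝ} (h : IsSubextremal M a) (hrp : rPlus M a < r)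
    (hr : 2 * M ≤ r) :
    scriSlope M a r ^ 2 * (r ^ 2 + a ^ 2) - 2 * M * r * (1 + scriSlope M a r) ^ 2 < r ^ 2 := by
  have hM := h.pos
  have hr0 : 0 < r := h.rPlus_pos.trans hrp
  set D : ℝ := (r - rPlus M a) * (r - rMinus M a) with hD
  have hDeq : D = r ^ 2 - 2 * M * r + a ^ 2 := sub_rPlus_mul_sub_rMinus h.sq_lt_sq.le r
  have hDpos : 0 < D := sub_rPlus_mul_sub_rMinus_pos hrp
  set s : ℝ := scriSlope M a r with hs
  -- `σ♯ · rΔ = w`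
  have hw : s * (r * D) = r * (r ^ 2 + a ^ 2) + 2 * M * D := by
    rw [hs, scriSlope, ← hD]
    field_simp
  -- the polynomial identity `(rΔ)² (r² − P(σ♯)) = −Δ N`
  have hid : (r * D) ^ 2 * (r ^ 2 - (s ^ 2 * (r ^ 2 + a ^ 2) - 2 * M * r * (1 + s) ^ 2)) =
      -D * ((a ^ 2 - 8 * M ^ 2) * r ^ 4 + 2 * M * a ^ 2 * r ^ 3 + (a ^ 2 - 4 * M ^ 2) ^ 2 * r ^ 2 +
        4 * M * a ^ 2 * (a ^ 2 - 4 * M ^ 2) * r + 4 * M ^ 2 * (a ^ 2) ^ 2) := by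
    rw [hDeq] at hw ⊢
    linear_combination
      (-(r ^ 2 + a ^ 2) * (r * (r ^ 2 - 2 * M * r + a ^ 2) * s +
            (r * (r ^ 2 + a ^ 2) + 2 * M * (r ^ 2 - 2 * M * r + a ^ 2))) +
        2 * M * r * (2 * (r * (r ^ 2 - 2 * M * r + a ^ 2)) +
          r * (r ^ 2 - 2 * M * r + a ^ 2) * s +
            (r * (r ^ 2 + a ^ 2) + 2 * M * (r ^ 2 - 2 * M * r + a ^ 2)))) * hw
  have hN := scri_quartic_neg (b := a ^ 2) hM (sq_nonneg a) h.sq_lt_sq hr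
  have hpos : 0 < (r * D) ^ 2 * (r ^ 2 - (s ^ 2 * (r ^ 2 + a ^ 2) - 2 * M * r * (1 + s) ^ 2)) := by
    rw [hid, neg_mul]
    exact neg_pos.2 (mul_neg_of_pos_of_neg hDpos hN)
  have hrD : 0 < (r * D) ^ 2 := by positivity
  have := (mul_pos_iff_of_pos_left hrD).1 hpos
  linarith

/-- `σ♯(r) > 0` for `r > r₊` (`(r² + a²)/Δ > 0`, `2M/r > 0`). [folklore] -/
theorem scriSlope_pos {M a r : ℝ} (h : IsSubextremal M a) (hrp : rPlus M a < r) :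
    0 < scriSlope M a r := by
  have hM := h.pos
  have hr0 : 0 < r := h.rPlus_pos.trans hrp
  have hD := sub_rPlus_mul_sub_rMinus_pos hrp
  unfold scriSlope
  positivity

/-- **Every slope between the Kerr–Schild slice and the far leaf is spacelike**: for
`0 ≤ c ≤ σ♯(r)` with `c = 0` or `r ≥ 2M`, `P(c) = c²(r² + a²) − 2Mr(1 + c)² < r²`. (Convexity:
`P(c) ≤ max(P(0), P(σ♯)) = max(−2Mr, P(σ♯))`.) [folklore] -/
theorem leafQuadratic_lt_sq {M a r c : ℝ} (h : IsSubextremal M a) (hrp : rPlus M a < r)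
    (hc0 : 0 ≤ c) (hcσ : c ≤ scriSlope M a r) (hcase : c = 0 ∨ 2 * M ≤ r) :
    c ^ 2 * (r ^ 2 + a ^ 2) - 2 * M * r * (1 + c) ^ 2 < r ^ 2 := by
  have hM := h.pos
  have hr0 : 0 < r := h.rPlus_pos.trans hrp
  have hr2 : 0 < r ^ 2 := by positivity
  have hMr : 0 < 2 * M * r := by positivity
  rcases hcase with hc | hr
  · subst hc
    nlinarith
  set s := scriSlope M a r with hs
  set D : ℝ := r ^ 2 - 2 * M * r + a ^ 2 with hD
  have hDpos : 0 < D := by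
    rw [hD, ← sub_rPlus_mul_sub_rMinus h.sq_lt_sq.le r]
    exact sub_rPlus_mul_sub_rMinus_pos hrp
  have hPs : s ^ 2 * D - 4 * M * r * s - 2 * M * r < r ^ 2 := by
    have := leafQuadratic_scriSlope_lt_sq h hrp hr
    rw [leafQuadratic_eq] at this
    exact this
  rw [leafQuadratic_eq]
  -- `c² Δ ≤ c σ Δ`
  have h1 : c ^ 2 * D ≤ c * s * D := by
    have : c ^ 2 ≤ c * s := by nlinarith
    exact mul_le_mul_of_nonneg_right this hDpos.le
  by_cases hsgn : s * D - 4 * M * r ≤ 0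
  · have h2 : c * (s * D - 4 * M * r) ≤ 0 := mul_nonpos_of_nonneg_of_nonpos hc0 hsgn
    nlinarith [h1, h2]
  · have hsgn' : 0 < s * D - 4 * M * r := not_le.1 hsgn
    have h2 : c * (s * D - 4 * M * r) ≤ s * (s * D - 4 * M * r) :=
      mul_le_mul_of_nonneg_right hcσ hsgn'.le
    nlinarith [h1, h2]

/-- **`g⁻¹(ν, ν) < 0` for the cut-off leaves**: for `|a| < M`, a far slope `σ` continuous on
`(r₊, ∞)` with `0 ≤ σ ≤ σ♯ = scriSlope M a` there, and `R₁ ≥ 2M`, `R₁ > r₊`, the conormal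
`ν = d(t* − h)` of the leaves of `h = cutoffHeight σ a R₁` is timelike at every point of the
exterior `{r > r₊}`: there `dh = c · dr` with `c = χ((r − R₁)/R₁) σ(r) ∈ [0, σ♯(r)]`, `c = 0`
unless `r > R₁ ≥ 2M`, and `Σ g⁻¹(ν, ν) = −Σ + P(c) ≤ −r² + P(c) < 0`. [folklore] -/
theorem leafConormal_coSharp_self_neg {M a R₁ : ℝ} {σ : ℝ → ℝ} (h : IsSubextremal M a)
    (hσc : ContinuousOn σ (Ioi (rPlus M a)))
    (hσ0 : ∀ s, rPlus M a < s → 0 ≤ σ s) (hσ1 : ∀ s, rPlus M a < s → σ s ≤ scriSlope M a s)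
    (hR : 2 * M ≤ R₁) (hRp : rPlus M a < R₁) (x : E4) (hx : rPlus M a < radius a x) :
    leafConormal (cutoffHeight σ a R₁) x
        (coSharp M a x (leafConormal (cutoffHeight σ a R₁) x)) < 0 := by
  obtain ⟨t, y, rfl⟩ : ∃ t y, x = E4.ofTimeSpace t y := ⟨_, _, (E4.ofTimeSpace_time_spatial x).symm⟩
  rw [radius_ofTimeSpace] at hx
  set r := radius a (E4.ofTimeSpace 0 y) with hr
  have hr0 : 0 < r := h.rPlus_pos.trans hx
  have hR0 : 0 < R₁ := h.rPlus_pos.trans hRp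
  set c : ℝ := Real.smoothTransition ((r - R₁) / R₁) * σ r with hc
  have hh : fderiv ℝ (cutoffHeight σ a R₁) y = c • radiusGrad a y :=
    (hasFDerivAt_cutoffHeight h.rPlus_pos.le hσc hRp hx).fderiv
  have hχ0 := Real.smoothTransition.nonneg ((r - R₁) / R₁)
  have hχ1 := Real.smoothTransition.le_one ((r - R₁) / R₁)
  have hc0 : 0 ≤ c := mul_nonneg hχ0 (hσ0 r hx)
  have hcσ : c ≤ scriSlope M a r :=
    calc c ≤ 1 * σ r := mul_le_mul_of_nonneg_right hχ1 (hσ0 r hx)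
      _ ≤ scriSlope M a r := by rw [one_mul]; exact hσ1 r hx
  have hcase : c = 0 ∨ 2 * M ≤ r := by
    by_cases hrR : r ≤ R₁
    · left
      have : (r - R₁) / R₁ ≤ 0 := div_nonpos_of_nonpos_of_nonneg (by linarith) hR0.le
      rw [hc, Real.smoothTransition.zero_of_nonpos this, zero_mul]
    · right
      linarith [not_le.1 hrR]
  have hP := leafQuadratic_lt_sq h hx hc0 hcσ hcase
  have hS := blSigma_pos hr0
  have hSr := sq_le_blSigma hr0
  rw [leafConormal_coSharp_of_radial hh hr0, div_neg_iff]
  right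
  exact ⟨by linarith, hS⟩

/-- `ν(V) > 0` for the cut-off leaves (`ν(V) = 1 + 2H(1 + c)`, `H ≥ 0`, `c ≥ 0`): the leaf normal
`−g♯ν` lies in the same timecone as `V`. [folklore] -/
theorem leafConormal_timeVector_pos {M a R₁ : ℝ} {σ : ℝ → ℝ} (h : IsSubextremal M a)
    (hσc : ContinuousOn σ (Ioi (rPlus M a))) (hσ0 : ∀ s, rPlus M a < s → 0 ≤ σ s)
    (hRp : rPlus M a < R₁) (x : E4) (hx : rPlus M a < radius a x) :
    0 < leafConormal (cutoffHeight σ a R₁) x (timeVector M a x) := by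
  obtain ⟨t, y, rfl⟩ : ∃ t y, x = E4.ofTimeSpace t y := ⟨_, _, (E4.ofTimeSpace_time_spatial x).symm⟩
  rw [radius_ofTimeSpace] at hx
  set r := radius a (E4.ofTimeSpace 0 y) with hr
  have hr0 : 0 < r := h.rPlus_pos.trans hx
  set c : ℝ := Real.smoothTransition ((r - R₁) / R₁) * σ r with hc
  have hh : fderiv ℝ (cutoffHeight σ a R₁) y = c • radiusGrad a y :=
    (hasFDerivAt_cutoffHeight h.rPlus_pos.le hσc hRp hx).fderiv
  have hc0 : 0 ≤ c := mul_nonneg (Real.smoothTransition.nonneg _) (hσ0 r hx)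
  have hH : 0 ≤ scalarH M a (E4.ofTimeSpace t y) := scalarH_nonneg h.pos.le a _
  rw [leafConormal_timeVector_of_radial hh hr0]
  positivity

/-! ### The leaf normal of `Σ̃_τ(h)` is future-directed timelike; the flux density is `≥ 0` -/

/-- `B(−u, −v) = B(u, v)` for a continuous bilinear form on `E4`. [folklore] -/
theorem _root_.Literature.Geometry.Lorentzian.E4.bilin_neg_neg (B : E4 →L[ℝ] E4 →L[ℝ] ℝ) (u v : E4) :
    B (-u) (-v) = B u v := by
  rw [B.map_neg u, _root_.neg_apply, (B u).map_neg v, neg_neg]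

/-- `B(u, −v) = −B(u, v)` for a continuous bilinear form on `E4`. [folklore] -/
theorem _root_.Literature.Geometry.Lorentzian.E4.bilin_neg_right (B : E4 →L[ℝ] E4 →L[ℝ] ℝ) (u v : E4) :
    B u (-v) = -B u v :=
  (B u).map_neg v

section LeafNormal

variable [Facts] {M a R₁ : ℝ} {σ : ℝ → ℝ}

/-- `g(W, W) = g⁻¹(ν, ν) = ν(g♯ν)` for the leaf normal `W = −g♯ν = −coSharp ν`. [folklore] -/
theorem bilin_leafNormal_leafNormal (M a : ℝ) (hgt : E3 → ℝ) (x : region a (rPlus M a)) :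
    bilin M a x.1 (leafNormal M a hgt x) (leafNormal M a hgt x) =
      leafConormal hgt x.1 (coSharp M a x.1 (leafConormal hgt x.1)) := by
  have key : bilin M a x.1 (-coSharp M a x.1 (leafConormal hgt x.1))
      (-coSharp M a x.1 (leafConormal hgt x.1)) =
        leafConormal hgt x.1 (coSharp M a x.1 (leafConormal hgt x.1)) := by
    rw [E4.bilin_neg_neg, bilin_coSharp M a (radius_pos_of_mem_region x.2)]
  unfold leafNormal
  rw [sharp_smoothMetric]
  exact key

/-- `g(V, W) = −ν(V)` for `W = −g♯ν`. [folklore] -/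
theorem bilin_timeVector_leafNormal (M a : ℝ) (hgt : E3 → ℝ) (x : region a (rPlus M a)) :
    bilin M a x.1 (timeVector M a x.1) (leafNormal M a hgt x) =
      -leafConormal hgt x.1 (timeVector M a x.1) := by
  have key : bilin M a x.1 (timeVector M a x.1) (-coSharp M a x.1 (leafConormal hgt x.1)) =
      -leafConormal hgt x.1 (timeVector M a x.1) := by
    rw [E4.bilin_neg_right, bilin_symm, bilin_coSharp M a (radius_pos_of_mem_region x.2)]
  unfold leafNormal
  rw [sharp_smoothMetric]
  exact key

/-- **The leaves `Σ̃_τ(h)` of a cut-off foliation with far slope between the Kerr–Schild slice and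
`scriSlope` have timelike normal** on the whole exterior `{r > r₊}`, for `|a| < M`, `R₁ ≥ 2M`,
`R₁ > r₊`: `g(W, W) = g⁻¹(ν, ν) < 0` (`leafConormal_coSharp_self_neg`). This is hypothesis (ii)
("`Σ̃₀` is spacelike") of DRSR Cor. 3.1 as restated by Moschidis (arXiv:1509.08489, §1.3.3) for
these leaves; cf. *The corrected foliation* in `KerrHyperboloidalFlux.lean`. [cite: DafermosRodnianskiShlapentokhrothman2014, §3.3 (Cor. 3.1); Moschidis2016 §1.3.3] -/
theorem isTimelike_leafNormal_cutoffHeight (h : IsSubextremal M a)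
    (hσc : ContinuousOn σ (Ioi (rPlus M a)))
    (hσ0 : ∀ s, rPlus M a < s → 0 ≤ σ s) (hσ1 : ∀ s, rPlus M a < s → σ s ≤ scriSlope M a s)
    (hR : 2 * M ≤ R₁) (hRp : rPlus M a < R₁) (x : region a (rPlus M a)) :
    (smoothMetric M a (rPlus M a)).IsTimelike (x := x)
      (leafNormal M a (cutoffHeight σ a R₁) x) := by
  rw [LorentzianMetric.isTimelike_iff, smoothMetric_val]
  have := leafConormal_coSharp_self_neg h hσc hσ0 hσ1 hR hRp x.1 (lt_radius_of_mem_region x.2)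
  rw [← bilin_leafNormal_leafNormal] at this
  exact this

/-- `g(V, W) < 0`: the leaf normal lies in the timecone of `V = −g♯dt*`. [folklore] -/
theorem bilin_timeVector_leafNormal_neg (h : IsSubextremal M a)
    (hσc : ContinuousOn σ (Ioi (rPlus M a))) (hσ0 : ∀ s, rPlus M a < s → 0 ≤ σ s)
    (hRp : rPlus M a < R₁) (x : region a (rPlus M a)) :
    bilin M a x.1 (timeVector M a x.1) (leafNormal M a (cutoffHeight σ a R₁) x) < 0 := by
  rw [bilin_timeVector_leafNormal]
  exact neg_neg_of_pos
    (leafConormal_timeVector_pos h hσc hσ0 hRp x.1 (lt_radius_of_mem_region x.2))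

/-- **The leaf normal is future-directed** for the Kerr time orientation `V = −g♯dt*`
(`Kerr.timeOrientation`, `0 ≤ M`). [folklore] -/
theorem isFutureDirected_leafNormal_cutoffHeight (h : IsSubextremal M a)
    (hσc : ContinuousOn σ (Ioi (rPlus M a)))
    (hσ0 : ∀ s, rPlus M a < s → 0 ≤ σ s) (hσ1 : ∀ s, rPlus M a < s → σ s ≤ scriSlope M a s)
    (hR : 2 * M ≤ R₁) (hRp : rPlus M a < R₁) (x : region a (rPlus M a)) :
    ((timeOrientation M a (rPlus M a) h.pos.le).ofLE le_top :
        TimeOrientation (smoothMetric M a (rPlus M a))).IsFutureDirected (x := x)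
      (leafNormal M a (cutoffHeight σ a R₁) x) := by
  refine ⟨(isTimelike_leafNormal_cutoffHeight h hσc hσ0 hσ1 hR hRp x).isCausal, ?_⟩
  rw [TimeOrientation.vectorField_ofLE, smoothMetric_val]
  exact bilin_timeVector_leafNormal_neg h hσc hσ0 hRp x

/-- **The flux density `T[ψ](V, W)` through the leaves is non-negative** (dominant energy
condition for the timelike future-directed pair `V`, `W`; `EnergyCurrents.lean`). DRSR
arXiv:1402.7034, §3.1 (the fluxes `∫ J^N_μ n^μ ≥ 0`). [cite: DafermosRodnianskiShlapentokhrothman2014, §3.1] -/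
theorem stressEnergy_timeVector_leafNormal_nonneg [SliceFacts] (h : IsSubextremal M a)
    (hσc : ContinuousOn σ (Ioi (rPlus M a)))
    (hσ0 : ∀ s, rPlus M a < s → 0 ≤ σ s) (hσ1 : ∀ s, rPlus M a < s → σ s ≤ scriSlope M a s)
    (hR : 2 * M ≤ R₁) (hRp : rPlus M a < R₁) (ψ : region a (rPlus M a) → ℝ)
    (x : region a (rPlus M a)) :
    0 ≤ (smoothMetric M a (rPlus M a)).stressEnergy ψ x (timeVector M a x.1)
      (leafNormal M a (cutoffHeight σ a R₁) x) := by
  refine (smoothMetric M a (rPlus M a)).stressEnergy_nonneg_of_isTimelike ?_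
    (isTimelike_leafNormal_cutoffHeight h hσc hσ0 hσ1 hR hRp x) ?_ ψ
  · exact bilin_timeVector_timeVector_neg h.pos.le a (radius_pos_of_mem_region x.2)
  · rw [smoothMetric_val]
    exact bilin_timeVector_leafNormal_neg h hσc hσ0 hRp x

end LeafNormal


/-! ### The leaves as spacelike immersions `Kerr.slice a r₊ → Kerr.exterior M a` -/

/-- The **leaf embedding** `y ↦ (τ + h(y), y)` of the slice `{r(0, ·) > max r₀ 0} ⊆ E3` onto the
leaf `Σ̃_τ(h) = {t* = τ + h(y)}` of the chart domain `Kerr.region a r₀` (the radius does not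
depend on `t*`, so leaf points over the slice lie in the region). DRSR arXiv:1402.7034, §3.3
(`Σ̃_τ = φ_τ(Σ̃₀)`). [cite: DafermosRodnianskiShlapentokhrothman2014, §3.3] -/
def leafEmbed (a r₀ : ℝ) (hgt : E3 → ℝ) (τ : ℝ) : slice a r₀ → region a r₀ :=
  fun y ↦ ⟨leafPoint hgt τ y, show E4.ofTimeSpace _ _ ∈ _ from ofTimeSpace_mem_region_iff.2 y.2⟩

/-- Unfolding lemma: `leafEmbed a r₀ h τ y = (τ + h y, y)` in `E4`. [folklore] -/
@[simp]
theorem coe_leafEmbed (a r₀ : ℝ) (hgt : E3 → ℝ) (τ : ℝ) (y : slice a r₀) :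
    (leafEmbed a r₀ hgt τ y : E4) = E4.ofTimeSpace (τ + hgt y) y := rfl

/-- For the zero height function and `τ = 0` the leaf embedding is the slice embedding
`Kerr.sliceEmbed` of `KerrData.lean`. [folklore] -/
theorem leafEmbed_zero (a r₀ : ℝ) : leafEmbed a r₀ (fun _ ↦ 0) 0 = sliceEmbed a r₀ := by
  funext y
  apply Subtype.ext
  simp

/-- **The differential of the leaf embedding** is `v ↦ (dh_y v, v) = (dh_y v) ∂₀ + (0, v)`.
[folklore] -/
theorem hasMFDerivAt_leafEmbed {a r₀ τ : ℝ} {hgt : E3 → ℝ} {hgt' : E3 →L[ℝ] ℝ} {y : slice a r₀}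
    (hh : HasFDerivAt hgt hgt' (y : E3)) :
    HasMFDerivAt 𝓘(ℝ, E3) 𝓘(ℝ, E4) (leafEmbed a r₀ hgt τ) y
      (hgt'.smulRight (E4.basisVector 0) + E4.spaceEmbed) := by
  have hΦ : HasFDerivAt (fun y : E3 ↦ E4.ofTimeSpace (τ + hgt y) y)
      (hgt'.smulRight (E4.basisVector 0) + E4.spaceEmbed) (y : E3) :=
    E4.hasFDerivAt_graphMap hh τ
  have h1 : HasMFDerivAt 𝓘(ℝ, E3) 𝓘(ℝ, E4) (fun y : slice a r₀ ↦ E4.ofTimeSpace (τ + hgt y) y) y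
      (hgt'.smulRight (E4.basisVector 0) + E4.spaceEmbed) := by
    have hmd : MDifferentiableAt 𝓘(ℝ, E3) 𝓘(ℝ, E4)
        (fun y : slice a r₀ ↦ E4.ofTimeSpace (τ + hgt y) y) y :=
      (OpensChart.mdifferentiableAt_iff y _ (fun y : E3 ↦ E4.ofTimeSpace (τ + hgt y) y)
        (fun _ ↦ rfl)).2 hΦ.differentiableAt
    have := hmd.hasMFDerivAt
    rwa [OpensChart.mfderiv_eq y _ (fun y : E3 ↦ E4.ofTimeSpace (τ + hgt y) y) (fun _ ↦ rfl)
      hΦ.differentiableAt, hΦ.fderiv] at this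
  exact OpensChart.hasMFDerivAt_codRestrict (fun _ ↦ rfl) h1

/-- **The leaf embedding is `C^∞`** when the height function is `C^∞` at the points of the
slice. [folklore] -/
theorem contMDiff_leafEmbed {a r₀ τ : ℝ} {hgt : E3 → ℝ}
    (hh : ∀ y : slice a r₀, ContDiffAt ℝ ∞ hgt (y : E3)) :
    ContMDiff 𝓘(ℝ, E3) 𝓘(ℝ, E4) ∞ (leafEmbed a r₀ hgt τ) := by
  intro y
  have hΦ : ContDiffAt ℝ ∞ (fun y : E3 ↦ E4.ofTimeSpace (τ + hgt y) y) (y : E3) := by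
    have : (fun y : E3 ↦ E4.ofTimeSpace (τ + hgt y) y) =
        fun y ↦ (τ + hgt y) • E4.basisVector 0 + E4.spaceEmbed y :=
      funext fun y ↦ E4.ofTimeSpace_eq_smul_add' _ _
    rw [this]
    exact ((contDiffAt_const.add (hh y)).smul contDiffAt_const).add E4.spaceEmbed.contDiff.contDiffAt
  have h1 : ContMDiffAt 𝓘(ℝ, E3) 𝓘(ℝ, E4) ∞
      (fun y : slice a r₀ ↦ E4.ofTimeSpace (τ + hgt y) y) y :=
    (OpensChart.contMDiffAt_iff y _ (fun y : E3 ↦ E4.ofTimeSpace (τ + hgt y) y)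
      (fun _ ↦ rfl)).2 hΦ
  exact (ChartedSpace.liftPropWithinAt_subtypeVal_comp_iff (leafEmbed a r₀ hgt τ) Set.univ y).mp
    h1

/-- Tangent vectors to a leaf are annihilated by its conormal: `ν((dh v, v)) = dh v − dh v = 0`.
[folklore] -/
theorem leafConormal_tangent (hgt : E3 → ℝ) (τ : ℝ) (y v : E3) :
    leafConormal hgt (leafPoint hgt τ y) (E4.ofTimeSpace (fderiv ℝ hgt y v) v) = 0 := by
  rw [leafConormal_apply, leafPoint, E4.spatial_ofTimeSpace, E4.spatial_ofTimeSpace,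
    E4.ofTimeSpace_apply_zero, sub_self]

/-- **A graph leaf with timelike normal is a spacelike immersion.** If the height `h` is `C^∞`
at the points of the exterior slice and the leaf normal `W = −g♯d(t* − h)` is timelike at every
point of the exterior, then `y ↦ (τ + h y, y)` is a spacelike immersion
`Kerr.slice a r₊ → Kerr.exterior M a`: tangent vectors `w = (dh v, v)` satisfy
`g(W, w) = −ν(w) = 0`, hence are spacelike (O'Neill 1983, Ch. 5, Lemma 5.26), and `w ≠ 0` for
`v ≠ 0`. [cite: ONeill1983, Ch. 5 Lemma 5.26] -/
theorem isSpacelikeImmersion_leafEmbed [Facts] {M a τ : ℝ} {hgt : E3 → ℝ}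
    (hh : ∀ y : slice a (rPlus M a), ContDiffAt ℝ ∞ hgt (y : E3))
    (htl : ∀ x : region a (rPlus M a),
      (smoothMetric M a (rPlus M a)).IsTimelike (x := x) (leafNormal M a hgt x)) :
    (smoothMetric M a (rPlus M a)).IsSpacelikeImmersion 𝓘(ℝ, E3)
      (leafEmbed a (rPlus M a) hgt τ) := by
  refine ⟨contMDiff_leafEmbed hh, fun y v hv ↦ ?_⟩
  have hd : HasFDerivAt hgt (fderiv ℝ hgt y) (y : E3) :=
    ((hh y).differentiableAt (by simp)).hasFDerivAt
  rw [PseudoRiemannianMetric.inducedBilin_apply, (hasMFDerivAt_leafEmbed hd).mfderiv,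
    smoothMetric_val]
  set x : region a (rPlus M a) := leafEmbed a (rPlus M a) hgt τ y with hx
  set w : E3 := v with hw
  have hw0 : w ≠ 0 := hv
  -- the tangent vector `(dh w, w)` is `g`-orthogonal to the leaf normal
  have horth : bilin M a x.1 (leafNormal M a hgt x) (E4.ofTimeSpace (fderiv ℝ hgt y w) w) = 0 := by
    have key : bilin M a x.1 (-coSharp M a x.1 (leafConormal hgt x.1))
        (E4.ofTimeSpace (fderiv ℝ hgt y w) w) = 0 := by
      rw [(bilin M a x.1).map_neg, _root_.neg_apply,
        bilin_coSharp M a (radius_pos_of_mem_region x.2), neg_eq_zero]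
      exact leafConormal_tangent hgt τ y w
    unfold leafNormal
    rw [sharp_smoothMetric]
    exact key
  have hsp := (smoothMetric M a (rPlus M a)).isSpacelike_of_orthogonal (htl x) horth
  rcases hsp with hpos | hzero
  · have hgoal : 0 < bilin M a x.1
        (((fderiv ℝ hgt y).smulRight (E4.basisVector 0) + E4.spaceEmbed) w)
        (((fderiv ℝ hgt y).smulRight (E4.basisVector 0) + E4.spaceEmbed) w) := by
      rw [E4.smulRight_add_spaceEmbed_apply]
      exact hpos
    exact hgoal
  · exfalso
    apply hw0
    have h0 : E4.ofTimeSpace (fderiv ℝ hgt y w) w = (0 : E4) := hzero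
    simpa using congrArg E4.spatial h0

/-! ### The corrected foliation `Σ̃_τ(h♯_{R₁})`: spacelike leaves with future timelike normal -/

/-- `r₊ ≤ 2M` for `a² ≤ M²`, `0 ≤ M` (`√(M² − a²) ≤ M`). O'Neill 1995, Ch. 2, §2.3. [cite: ONeill1995, Ch. 2 §2.3] -/
theorem rPlus_le_two_mul {M a : ℝ} (hM : 0 ≤ M) : rPlus M a ≤ 2 * M := by
  unfold rPlus
  have : √(M ^ 2 - a ^ 2) ≤ M := by
    rw [Real.sqrt_le_left hM]  -- √x ≤ y ↔ x ≤ y² for 0 ≤ y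
    nlinarith [sq_nonneg a]
  linarith

/-- `σ♯ = scriSlope M a` is `C^∞` on `(r₊, ∞)` (a rational function with non-vanishing
denominators `Δ = (s − r₊)(s − r₋)` and `s` there). [folklore] -/
theorem contDiffOn_scriSlope {M a : ℝ} (h : IsSubextremal M a) :
    ContDiffOn ℝ ∞ (scriSlope M a) (Ioi (rPlus M a)) := by
  have h1 : ContDiffOn ℝ ∞ (fun s : ℝ ↦ (s ^ 2 + a ^ 2) / ((s - rPlus M a) * (s - rMinus M a)))
      (Ioi (rPlus M a)) :=
    ContDiffOn.div (by fun_prop) (by fun_prop) fun s hs ↦ (sub_rPlus_mul_sub_rMinus_pos hs).ne'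
  have h2 : ContDiffOn ℝ ∞ (fun s : ℝ ↦ 2 * M / s) (Ioi (rPlus M a)) :=
    ContDiffOn.div (by fun_prop) (by fun_prop) fun s hs ↦ (h.rPlus_pos.trans hs).ne'
  exact (h1.add h2).congr fun s _ ↦ rfl

/-- `h♯_{R₁}` is `C^∞` at the points of the exterior slice, for `R₁ > r₊`. [folklore] -/
theorem contDiffAt_scriHeight {M a R₁ : ℝ} (h : IsSubextremal M a) (hRp : rPlus M a < R₁)
    (y : slice a (rPlus M a)) : ContDiffAt ℝ ∞ (scriHeight M a R₁) (y : E3) := by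
  have hy : rPlus M a < radius a (E4.ofTimeSpace 0 (y : E3)) := by
    have := y.2
    rw [mem_slice, max_eq_left h.rPlus_pos.le] at this
    exact this
  have hopen : IsOpen {y : E3 | rPlus M a < radius a (E4.ofTimeSpace 0 y)} :=
    isOpen_lt continuous_const ((continuous_radius a).comp (E4.continuous_ofTimeSpace 0))
  exact (contDiffOn_cutoffHeight h.rPlus_pos.le (contDiffOn_scriSlope h) hRp).contDiffAt
    (hopen.mem_nhds hy)

/-- **The normal of the leaves `Σ̃_τ(h♯_{R₁})` is timelike** everywhere on the exterior, for
`|a| < M` and `R₁ > 2M` ((ii) of *The corrected foliation*, `KerrHyperboloidalFlux.lean`; this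
is the spacelikeness hypothesis on `Σ̃₀` of DRSR Cor. 3.1 / Moschidis §1.3.3 for the vendored
fact `Kerr.drsr_corollary_3_1_scri_flux_decay`, now proved with `R₀ = 2M`). [cite: DafermosRodnianskiShlapentokhrothman2014, §3.3 (Cor. 3.1); Moschidis2016 §1.3.3] -/
theorem isTimelike_leafNormal_scriHeight [Facts] {M a R₁ : ℝ} (h : IsSubextremal M a)
    (hR : 2 * M < R₁) (x : region a (rPlus M a)) :
    (smoothMetric M a (rPlus M a)).IsTimelike (x := x) (leafNormal M a (scriHeight M a R₁) x) :=
  isTimelike_leafNormal_cutoffHeight h (contDiffOn_scriSlope h).continuousOn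
    (fun _ hs ↦ (scriSlope_pos h hs).le) (fun _ _ ↦ le_rfl) hR.le
    ((rPlus_le_two_mul h.pos.le).trans_lt hR) x

/-- **The normal of the leaves `Σ̃_τ(h♯_{R₁})` is future-directed** (`R₁ > 2M`). [folklore] -/
theorem isFutureDirected_leafNormal_scriHeight [Facts] {M a R₁ : ℝ} (h : IsSubextremal M a)
    (hR : 2 * M < R₁) (x : region a (rPlus M a)) :
    ((timeOrientation M a (rPlus M a) h.pos.le).ofLE le_top :
        TimeOrientation (smoothMetric M a (rPlus M a))).IsFutureDirected (x := x)
      (leafNormal M a (scriHeight M a R₁) x) :=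
  isFutureDirected_leafNormal_cutoffHeight h (contDiffOn_scriSlope h).continuousOn
    (fun _ hs ↦ (scriSlope_pos h hs).le) (fun _ _ ↦ le_rfl) hR.le
    ((rPlus_le_two_mul h.pos.le).trans_lt hR) x

/-- **The flux density of `Kerr.drsr_corollary_3_1_scri_flux_decay` is honestly non-negative**:
`0 ≤ T[ψ](V, W)` at every point of the exterior for the leaves `Σ̃_τ(h♯_{R₁})`, `R₁ > 2M`
(so the `ENNReal.ofReal` in `Kerr.leafFluxDensity` truncates nothing). DRSR arXiv:1402.7034,
§3.1. [cite: DafermosRodnianskiShlapentokhrothman2014, §3.1] -/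
theorem stressEnergy_timeVector_leafNormal_scriHeight_nonneg [Facts] [SliceFacts] {M a R₁ : ℝ}
    (h : IsSubextremal M a) (hR : 2 * M < R₁) (ψ : region a (rPlus M a) → ℝ)
    (x : region a (rPlus M a)) :
    0 ≤ (smoothMetric M a (rPlus M a)).stressEnergy ψ x (timeVector M a x.1)
      (leafNormal M a (scriHeight M a R₁) x) :=
  stressEnergy_timeVector_leafNormal_nonneg h (contDiffOn_scriSlope h).continuousOn
    (fun _ hs ↦ (scriSlope_pos h hs).le) (fun _ _ ↦ le_rfl) hR.le
    ((rPlus_le_two_mul h.pos.le).trans_lt hR) ψ x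

/-- **The leaves `Σ̃_τ(h♯_{R₁})` are spacelike hypersurfaces of the Kerr exterior**: for `|a| < M`,
`R₁ > 2M` and every `τ`, the leaf embedding `y ↦ (τ + h♯_{R₁}(y), y)` is a `C^∞` spacelike
immersion `Kerr.slice a r₊ → Kerr.exterior M a` in the sense of `Hypersurface.lean`. This is
hypothesis (ii) of *The corrected foliation* (`KerrHyperboloidalFlux.lean`), i.e. the
spacelikeness of `Σ̃₀` required by DRSR Cor. 3.1 (arXiv:1402.7034, §3.3) as restated in
Moschidis arXiv:1509.08489, §1.3.3. [cite: DafermosRodnianskiShlapentokhrothman2014, §3.3 (Cor. 3.1); Moschidis2016 §1.3.3] -/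
theorem isSpacelikeImmersion_scriLeaf [Facts] {M a R₁ : ℝ} (h : IsSubextremal M a)
    (hR : 2 * M < R₁) (τ : ℝ) :
    (smoothMetric M a (rPlus M a)).IsSpacelikeImmersion 𝓘(ℝ, E3)
      (leafEmbed a (rPlus M a) (scriHeight M a R₁) τ) :=
  isSpacelikeImmersion_leafEmbed
    (contDiffAt_scriHeight h ((rPlus_le_two_mul h.pos.le).trans_lt hR))
    (isTimelike_leafNormal_scriHeight h hR)


/-! ### The first version's leaves `Σ̃_τ(h_{R₁})` are spacelike too (they merely reach `i⁰`) -/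

/-- `hypSlope = σ♯ − M/s` is continuous on `(r₊, ∞)`. [folklore] -/
theorem continuousOn_hypSlope {M a : ℝ} (h : IsSubextremal M a) :
    ContinuousOn (hypSlope M a) (Ioi (rPlus M a)) := by
  have h1 : ContinuousOn (fun s : ℝ ↦ M / s) (Ioi (rPlus M a)) :=
    continuousOn_const.div continuousOn_id fun s hs ↦ (h.rPlus_pos.trans hs).ne'
  exact ((contDiffOn_scriSlope h).continuousOn.sub h1).congr fun s _ ↦
    hypSlope_eq_scriSlope_sub M a s

/-- `0 ≤ hypSlope ≤ scriSlope` on `(r₊, ∞)` (`hypSlope = (s² + a²)/Δ + M/s = σ♯ − M/s`).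
[folklore] -/
theorem hypSlope_nonneg_and_le {M a s : ℝ} (h : IsSubextremal M a) (hs : rPlus M a < s) :
    0 ≤ hypSlope M a s ∧ hypSlope M a s ≤ scriSlope M a s := by
  have hM := h.pos
  have hs0 : 0 < s := h.rPlus_pos.trans hs
  have hD := sub_rPlus_mul_sub_rMinus_pos hs
  refine ⟨?_, ?_⟩
  · unfold hypSlope; positivity
  · rw [hypSlope_eq_scriSlope_sub, sub_le_self_iff]; positivity

/-- The leaves `Σ̃_τ(h_{R₁})` of the first (mis-stated) version of
`KerrHyperboloidalFlux.lean` also have timelike future-directed normal for `R₁ > 2M`: they are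
perfectly good spacelike hypersurfaces — asymptotically null ones reaching spacelike infinity
`i⁰` — which is why the flux through them does not decay (erratum in that file); causality was
never the issue. [folklore] -/
theorem isTimelike_leafNormal_hypHeight [Facts] {M a R₁ : ℝ} (h : IsSubextremal M a)
    (hR : 2 * M < R₁) (x : region a (rPlus M a)) :
    (smoothMetric M a (rPlus M a)).IsTimelike (x := x) (leafNormal M a (hypHeight M a R₁) x) :=
  isTimelike_leafNormal_cutoffHeight h (continuousOn_hypSlope h)
    (fun _ hs ↦ (hypSlope_nonneg_and_le h hs).1) (fun _ hs ↦ (hypSlope_nonneg_and_le h hs).2) hR.le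
    ((rPlus_le_two_mul h.pos.le).trans_lt hR) x


end Kerr

end Literature.Geometry.Lorentzian

end
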